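import Mathlib
import Literature.Geometry.Symplectic.JHolomorphicMap
import Literature.Geometry.Symplectic.JHolomorphicWeierstrass
import Literature.Geometry.Symplectic.JHolomorphicWeierstrassAprioriEnergy
import Literature.Geometry.Symplectic.JHolomorphicWeierstrassAprioriSteps
import HarnessLib

/-!
# The generalized Weierstraß theorem for `J`-holomorphic maps (Hummel 1997, III.3.1) — PROVED

Part 3/3: the discharge `Literature.Geometry.Symplectic.JHolomorphicWeierstrassR4_holds` of the
named fact `Literature.Geometry.Symplectic.JHolomorphicWeierstrassR4`
(`Literature/Geometry/Symplectic/JHolomorphicWeierstrass.lean`; C. Hummel, *Gromov's compactness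
theorem for pseudo-holomorphic curves* (1997), Ch. III Prop. 3.1 in the flat four-dimensional
form: for a `C^∞` almost complex structure `J` on `ℝ⁴`, maps `u n : ℂ → ℝ⁴` that are `C^∞` and
flat `J`-holomorphic on an open `U ⊆ ℂ` and converge locally uniformly on `U` to `v` have a
limit that is `C^∞` and `J`-holomorphic on `U`, and `d(u n) → dv` locally uniformly on `U`).

Assembly (McDuff–Salamon 2012, Thm B.4.2 with `p = ∞`, in `L²` form):
* `Apriori.bootstrap` / `bootstrap_local`, `helper_aprioriLocal_of`: the bootstrapping induction
  on shrinking discs — each round `α, α, β, α, γ` turns sup bounds on derivatives of order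
  `≤ m + 1` into order `≤ m + 2` — giving `‖Dᵏg(0)‖ ≤ C(J, R₀, k)` for `g` smooth,
  `J`-holomorphic on the disc of radius `2`, `‖g‖ ≤ R₀` and `‖dg‖ ≤ 2` on the unit disc;
* `helper_alphaLocal`: the local step `α`;
* `helper_gradBoundOfC0_of` (with `helper_flatZalcman`, `GradBound.*`): `C⁰_loc` convergence
  forces local `C¹` bounds (Zalcman rescaling at a blow-up point would produce maps with unit
  gradient at the origin converging in `C¹` to a constant);
* `helper_smoothLimitLocal`: derivative bounds + locally uniform convergence ⇒ the limit is `C^∞`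
  and first derivatives converge locally uniformly; the equation passes to the limit pointwise.
Stated for `ℂ → EuclideanSpace ℝ (Fin d)`; the fact is the case `d = 4`.

Provenance: Summits-side files `Theorems/SullivanDualTameOrBrodyR4AprioriBootstrap.lean`,
`…WitnessChargeHelper{FlatZalcman,SmoothLimitLocal,GradBoundOfC0Aux,GradBoundOfC0,AlphaLocal,AprioriLocal}.lean`
and `…WitnessChargeWeierstrass.lean` of summit `SmoothPoincare4` (where the fact was first
discharged, Summits-side), re-homed verbatim (namespace
`Literature.Geometry.Symplectic.JHolomorphicWeierstrassProof`, `4 ↦ d`; promotion request event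
3680949). Original module headers are kept below as section headers.

## References

* C. Hummel, *Gromov's Compactness Theorem for Pseudo-holomorphic Curves*, Progress in Math. 151
  (1997), Ch. III Prop. 3.1; Ch. II Cor. 1.2. [Hummel1997]
* D. McDuff, D. Salamon, *J-holomorphic curves and symplectic topology*, 2nd ed. (2012),
  Thm B.4.2. [McDuffSalamon2012]
-/

noncomputable section

/-!
## Part `SullivanDualTameOrBrodyR4AprioriBootstrap`:
### A-priori estimate for `J`-holomorphic maps: part 7, the bootstrapping induction

Helper file of the lead (c2) for stub `stub_aprioriOf` of line `Sketch`, crux `TameOrBrodyR4`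
(stmt-SmoothPoincare4-7826, route SullivanDual). The induction (registered sub-goal `bootstrap`): on discs of radii `r t = δ/2 + δ/(2(t+2))`, each round `α, α, β, α, γ` turns sup bounds on the orders `≤ m + 1` into sup bounds on the orders `≤ m + 2`.
-/

open scoped ContDiff Topology Nat
open Filter Set Literature.Geometry.Symplectic

namespace Literature.Geometry.Symplectic.JHolomorphicWeierstrassProof

variable {d : ℕ}
namespace Apriori

/-! ### The bootstrapping induction and the a-priori estimate -/

section Induction

open MeasureTheory Metric

/-- A set integral of a power of a bounded nonnegative continuous function on a disc. [folklore] -/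
theorem setIntegral_pow_le_of_le {f : ℂ → ℝ} (hf : Continuous f) (hf0 : ∀ z, 0 ≤ f z) {ρ S : ℝ}
    (hS : ∀ z ∈ closedBall (0 : ℂ) ρ, f z ≤ S) (k : ℕ) :
    ∫ z in closedBall (0 : ℂ) ρ, f z ^ k ≤ (volume (closedBall (0 : ℂ) ρ)).toReal * S ^ k := by
  calc ∫ z in closedBall (0 : ℂ) ρ, f z ^ k ≤ ∫ _ in closedBall (0 : ℂ) ρ, S ^ k :=
        setIntegral_mono_on (integrableOn_closedBall_of_continuous (hf.pow k) 0 ρ)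
          (integrableOn_closedBall_of_continuous continuous_const 0 ρ) measurableSet_closedBall
          fun z hz => pow_le_pow_left₀ (hf0 z) (hS z hz) k
    _ = (volume (closedBall (0 : ℂ) ρ)).toReal * S ^ k := by
        rw [setIntegral_const, smul_eq_mul]; rfl

/-- Monotonicity of set integrals of nonnegative continuous functions in the radius. [folklore] -/
theorem setIntegral_closedBall_mono {f : ℂ → ℝ} (hf : Continuous f) (hf0 : ∀ z, 0 ≤ f z) {r₁ r₂ : ℝ}
    (h : r₁ ≤ r₂) : ∫ z in closedBall (0 : ℂ) r₁, f z ≤ ∫ z in closedBall (0 : ℂ) r₂, f z :=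
  setIntegral_mono_set (integrableOn_closedBall_of_continuous hf 0 r₂)
    (Filter.Eventually.of_forall fun z => hf0 z) (closedBall_subset_closedBall h).eventuallyLE

/-- Set integrals of squared norms of derivatives are nonnegative. [folklore] -/
theorem setIntegral_norm_pow_nonneg (g : ℂ → (EuclideanSpace ℝ (Fin d))) (k p : ℕ) (ρ : ℝ) :
    0 ≤ ∫ z in closedBall (0 : ℂ) ρ, ‖iteratedFDeriv ℝ k g z‖ ^ p :=
  integral_nonneg fun _ => pow_nonneg (norm_nonneg _) p

/-- **The bootstrapping induction.** With `r t = δ/2 + δ/(2(t+2))` (radii decreasing from `3δ/4`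
to `δ/2`), for every `m` there is `S` with `‖Dⁱg‖ ≤ S` on the disc of radius `r (5m)` for all
`i ≤ m + 1` and all admissible `g` (steps `α, α, β, α, γ` per round). [folklore] -/
theorem bootstrap
    (h1 : ∀ (A₀ : (EuclideanSpace ℝ (Fin d)) →L[ℝ] (EuclideanSpace ℝ (Fin d))), (∀ v, A₀ (A₀ v) = -v) → ∀ (W : ℂ → (EuclideanSpace ℝ (Fin d))), ContDiff ℝ ∞ W →
      HasCompactSupport W → (∫ z, (‖fderiv ℝ W z 1‖ ^ 2 + ‖fderiv ℝ W z Complex.I‖ ^ 2)) ≤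
        (1 + ‖A₀‖ ^ 2) * ∫ z, ‖fderiv ℝ W z Complex.I - A₀ (fderiv ℝ W z 1)‖ ^ 2)
    (hL : ∃ C : ℝ, ∀ (W : ℂ → (EuclideanSpace ℝ (Fin d))), ContDiff ℝ ∞ W → HasCompactSupport W →
      (∫ z, ‖W z‖ ^ 4) ≤ C * ((∫ z, ‖W z‖ ^ 2) *
        ∫ z, (‖fderiv ℝ W z 1‖ ^ 2 + ‖fderiv ℝ W z Complex.I‖ ^ 2)))
    (hS : ∀ (W : ℂ → (EuclideanSpace ℝ (Fin d))), ContDiff ℝ ∞ W → HasCompactSupport W → ∀ z : ℂ,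
      ‖W z‖ ≤ ∫ y, ‖fderiv ℝ (fun x => fderiv ℝ W x 1) y Complex.I‖)
    (hB : ∀ (n : ℕ) (T : ContinuousMultilinearMap ℝ (fun _ : Fin n => ℂ) (EuclideanSpace ℝ (Fin d))),
      ‖T‖ ≤ ∑ L : Fin n → Fin 2, ‖T (fun j => ![(1 : ℂ), Complex.I] (L j))‖)
    {J : (EuclideanSpace ℝ (Fin d)) → (EuclideanSpace ℝ (Fin d)) →L[ℝ] (EuclideanSpace ℝ (Fin d))} (hJs : ContDiff ℝ ∞ J) (hJ2 : ∀ x v, J x (J x v) = -v)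
    {R₀ M₀ M₁ : ℝ} (hM₀ : ∀ x : (EuclideanSpace ℝ (Fin d)), ‖x‖ ≤ R₀ → ‖J x‖ ≤ M₀)
    (hM₁ : ∀ x : (EuclideanSpace ℝ (Fin d)), ‖x‖ ≤ R₀ → ‖fderiv ℝ J x‖ ≤ M₁)
    {δ : ℝ} (hδ0 : 0 < δ) (hδ1 : δ ≤ 1) (hδ : 16 * (1 + M₀ ^ 2) * M₁ ^ 2 * δ ^ 2 ≤ 1) (m : ℕ) :
    ∃ S : ℝ, ∀ g : ℂ → (EuclideanSpace ℝ (Fin d)), ContDiff ℝ ∞ g → IsJHolomorphicFlat J g →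
      (∀ z : ℂ, ‖z‖ ≤ 1 → ‖g z‖ ≤ R₀) → (∀ z : ℂ, ‖z‖ ≤ 1 → ‖fderiv ℝ g z‖ ≤ 2) →
      ∀ i, i ≤ m + 1 → ∀ z : ℂ, ‖z‖ ≤ δ / 2 + δ / (2 * ((5 * m : ℕ) + 2)) →
        ‖iteratedFDeriv ℝ i g z‖ ≤ S := by
  -- the radii
  obtain ⟨r, hr⟩ : ∃ r : ℕ → ℝ, r = fun t : ℕ => δ / 2 + δ / (2 * ((t : ℝ) + 2)) := ⟨_, rfl⟩
  have hr5 : ∀ m : ℕ, r (5 * m) = δ / 2 + δ / (2 * ((5 * m : ℕ) + 2)) := fun m => by rw [hr]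
  have hr_pos : ∀ t, 0 < r t := fun t => by rw [hr]; positivity
  have hr_le : ∀ t, r t ≤ δ := fun t => by
    rw [hr]
    have : δ / (2 * ((t : ℝ) + 2)) ≤ δ / 2 :=
      div_le_div_of_nonneg_left hδ0.le (by norm_num)
        (by nlinarith [(Nat.cast_nonneg t : (0 : ℝ) ≤ t)])
    show δ / 2 + δ / (2 * ((t : ℝ) + 2)) ≤ δ
    linarith
  have hr_anti : ∀ t t' : ℕ, t ≤ t' → r t' ≤ r t := fun t t' htt => by
    rw [hr]
    have : δ / (2 * ((t' : ℝ) + 2)) ≤ δ / (2 * ((t : ℝ) + 2)) :=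
      div_le_div_of_nonneg_left hδ0.le (by positivity) (by
        have : (t : ℝ) ≤ t' := by exact_mod_cast htt
        linarith)
    show δ / 2 + δ / (2 * ((t' : ℝ) + 2)) ≤ δ / 2 + δ / (2 * ((t : ℝ) + 2))
    linarith
  have hr_lt : ∀ t : ℕ, r (t + 1) < r t := fun t => by
    rw [hr]
    have : δ / (2 * (((t + 1 : ℕ) : ℝ) + 2)) < δ / (2 * ((t : ℝ) + 2)) :=
      div_lt_div_of_pos_left hδ0 (by positivity) (by push_cast; linarith)
    show δ / 2 + δ / (2 * (((t + 1 : ℕ) : ℝ) + 2)) < δ / 2 + δ / (2 * ((t : ℝ) + 2))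
    linarith
  have hr1 : ∀ t, r t ≤ 1 := fun t => (hr_le t).trans hδ1
  have hrδ : ∀ t, 16 * (1 + M₀ ^ 2) * M₁ ^ 2 * r t ^ 2 ≤ 1 := fun t => by
    have : r t ^ 2 ≤ δ ^ 2 := pow_le_pow_left₀ (hr_pos t).le (hr_le t) 2
    have h0 : 0 ≤ 16 * (1 + M₀ ^ 2) * M₁ ^ 2 := by positivity
    nlinarith [mul_le_mul_of_nonneg_left this h0]
  -- restate the goal with `r`
  suffices H : ∃ S : ℝ, ∀ g : ℂ → (EuclideanSpace ℝ (Fin d)), ContDiff ℝ ∞ g → IsJHolomorphicFlat J g →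
      (∀ z : ℂ, ‖z‖ ≤ 1 → ‖g z‖ ≤ R₀) → (∀ z : ℂ, ‖z‖ ≤ 1 → ‖fderiv ℝ g z‖ ≤ 2) →
      ∀ i, i ≤ m + 1 → ∀ z : ℂ, ‖z‖ ≤ r (5 * m) → ‖iteratedFDeriv ℝ i g z‖ ≤ S by
    obtain ⟨S, hS'⟩ := H
    exact ⟨S, fun g hg hgJ hg0 hg1 i hi z hz => hS' g hg hgJ hg0 hg1 i hi z (by rw [hr5]; exact hz)⟩
  induction m with
  | zero =>
    refine ⟨max R₀ 2, fun g hg hgJ hg0 hg1 i hi z hz => ?_⟩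
    have hz1 : ‖z‖ ≤ 1 := hz.trans (hr1 _)
    interval_cases i
    · rw [norm_iteratedFDeriv_zero]; exact (hg0 z hz1).trans (le_max_left _ _)
    · rw [norm_iteratedFDeriv_one]; exact (hg1 z hz1).trans (le_max_right _ _)
  | succ m ih =>
    obtain ⟨S, hSb⟩ := ih
    -- the five steps, with their `g`-independent constants
    have hn1 : 1 ≤ m + 1 := by omega
    obtain ⟨CA, hCA⟩ := alpha h1 hB hJs hJ2 hM₀ hM₁ (n := m + 1) hn1 (hr_pos (5 * m + 1))
      (hr_lt (5 * m)) (hr1 _) (hrδ _) S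
    obtain ⟨CB, hCB⟩ := alpha h1 hB hJs hJ2 hM₀ hM₁ (n := m + 2) (by omega) (hr_pos (5 * m + 2))
      (hr_lt (5 * m + 1)) (hr1 _) (hrδ _) S
    obtain ⟨CC, hCC⟩ := beta hL hB (m + 2) (hr_pos (5 * m + 3)) (hr_lt (5 * m + 2))
    obtain ⟨CD, hCD⟩ := alpha h1 hB hJs hJ2 hM₀ hM₁ (n := m + 3) (by omega) (hr_pos (5 * m + 4))
      (hr_lt (5 * m + 3)) (hr1 _) (hrδ _) S
    obtain ⟨CE, hCE⟩ := gamma hS hB (m + 2) (hr_pos (5 * m + 5)) (hr_lt (5 * m + 4))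
    -- volumes
    obtain ⟨V0, hV0⟩ : ∃ V : ℝ, V = (volume (closedBall (0 : ℂ) (r (5 * m)))).toReal := ⟨_, rfl⟩
    obtain ⟨V1, hV1⟩ : ∃ V : ℝ, V = (volume (closedBall (0 : ℂ) (r (5 * m + 1)))).toReal := ⟨_, rfl⟩
    -- the propagated bounds
    obtain ⟨Q₁, hQ₁⟩ : ∃ Q : ℝ, Q = |CA| * (1 + V0 * (max S |R₀|) ^ 4 + V0 * S ^ 2) := ⟨_, rfl⟩
    obtain ⟨Q₂, hQ₂⟩ : ∃ Q : ℝ, Q = |CB| * (1 + V1 * S ^ 4 + Q₁) := ⟨_, rfl⟩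
    obtain ⟨P, hP⟩ : ∃ Q : ℝ, Q = |CC| * (Q₁ * (Q₂ + Q₁)) := ⟨_, rfl⟩
    obtain ⟨Q₃, hQ₃⟩ : ∃ Q : ℝ, Q = |CD| * (1 + P + Q₂) := ⟨_, rfl⟩
    refine ⟨max S (|CE| * (1 + Q₃ + Q₂ + Q₁)), fun g hg hgJ hg0 hg1 i hi z hz => ?_⟩
    have hac : ∀ k, Continuous fun z => ‖iteratedFDeriv ℝ k g z‖ := fun k =>
      (hg.continuous_iteratedFDeriv (m := k) (by exact_mod_cast le_top)).norm
    have hnn : ∀ (k p : ℕ) (ρ : ℝ), 0 ≤ ∫ z in closedBall (0 : ℂ) ρ, ‖iteratedFDeriv ℝ k g z‖ ^ p :=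
      fun k p ρ => setIntegral_norm_pow_nonneg g k p ρ
    -- sup bounds from the induction hypothesis, on the disc of radius `r (5m)` and inside
    have hsup : ∀ i, i ≤ m + 1 → ∀ t, 5 * m ≤ t → ∀ z ∈ closedBall (0 : ℂ) (r t),
        ‖iteratedFDeriv ℝ i g z‖ ≤ S := fun i hi t ht z hz =>
      hSb g hg hgJ hg0 hg1 i hi z ((mem_closedBall_zero_iff.mp hz).trans (hr_anti _ _ ht))
    -- step A
    have hA : ∫ z in closedBall (0 : ℂ) (r (5 * m + 1)), ‖iteratedFDeriv ℝ (m + 1 + 1) g z‖ ^ 2 ≤ Q₁ := by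
      have h := hCA g hg hgJ hg0 hg1 (fun i hi1 hi2 z hz =>
        hsup i (by omega) (5 * m) le_rfl z (mem_closedBall_zero_iff.mpr hz))
      refine h.trans ?_
      rw [hQ₁]
      have i4 : ∫ z in closedBall (0 : ℂ) (r (5 * m)), ‖iteratedFDeriv ℝ (m + 1 - 1) g z‖ ^ 4 ≤
          V0 * (max S |R₀|) ^ 4 := by
        rw [hV0]
        refine setIntegral_pow_le_of_le (hac (m + 1 - 1)) (fun z => norm_nonneg _) (fun z hz => ?_) 4
        rcases Nat.eq_zero_or_pos m with hm | hm
        · subst hm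
          show ‖iteratedFDeriv ℝ 0 g z‖ ≤ _
          rw [norm_iteratedFDeriv_zero]
          exact ((hg0 z ((mem_closedBall_zero_iff.mp hz).trans (hr1 _))).trans (le_abs_self _)).trans
            (le_max_right _ _)
        · exact (hsup (m + 1 - 1) (by omega) (5 * m) le_rfl z hz).trans (le_max_left _ _)
      have i2 : ∫ z in closedBall (0 : ℂ) (r (5 * m)), ‖iteratedFDeriv ℝ (m + 1) g z‖ ^ 2 ≤
          V0 * S ^ 2 := by
        rw [hV0]
        exact setIntegral_pow_le_of_le (hac _) (fun z => norm_nonneg _)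
          (fun z hz => hsup (m + 1) le_rfl (5 * m) le_rfl z hz) 2
      have hx4 := hnn (m + 1 - 1) 4 (r (5 * m))
      have hx2 := hnn (m + 1) 2 (r (5 * m))
      calc CA * _ ≤ |CA| * _ := mul_le_mul_of_nonneg_right (le_abs_self _) (by linarith)
        _ ≤ _ := mul_le_mul_of_nonneg_left (by linarith) (abs_nonneg _)
    have hQ₁0 : 0 ≤ Q₁ := (hnn _ _ _).trans hA
    -- step B
    have hBstep : ∫ z in closedBall (0 : ℂ) (r (5 * m + 2)), ‖iteratedFDeriv ℝ (m + 2 + 1) g z‖ ^ 2 ≤ Q₂ := by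
      have h := hCB g hg hgJ hg0 hg1 (fun i hi1 hi2 z hz =>
        hsup i (by omega) (5 * m + 1) (by omega) z (mem_closedBall_zero_iff.mpr hz))
      refine h.trans ?_
      rw [hQ₂]
      have i4 : ∫ z in closedBall (0 : ℂ) (r (5 * m + 1)), ‖iteratedFDeriv ℝ (m + 2 - 1) g z‖ ^ 4 ≤
          V1 * S ^ 4 := by
        rw [hV1]
        exact setIntegral_pow_le_of_le (hac _) (fun z => norm_nonneg _)
          (fun z hz => hsup (m + 2 - 1) (by omega) (5 * m + 1) (by omega) z hz) 4
      have hA' : ∫ z in closedBall (0 : ℂ) (r (5 * m + 1)), ‖iteratedFDeriv ℝ (m + 2) g z‖ ^ 2 ≤ Q₁ := hA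
      have hx4 := hnn (m + 2 - 1) 4 (r (5 * m + 1))
      have hx2 := hnn (m + 2) 2 (r (5 * m + 1))
      calc CB * _ ≤ |CB| * _ := mul_le_mul_of_nonneg_right (le_abs_self _) (by linarith)
        _ ≤ _ := mul_le_mul_of_nonneg_left (by linarith) (abs_nonneg _)
    have hQ₂0 : 0 ≤ Q₂ := (hnn _ _ _).trans hBstep
    -- step C
    have hA2 : ∫ z in closedBall (0 : ℂ) (r (5 * m + 2)), ‖iteratedFDeriv ℝ (m + 2) g z‖ ^ 2 ≤ Q₁ :=
      (setIntegral_closedBall_mono ((hac (m + 2)).pow 2) (fun z => pow_nonneg (norm_nonneg _) 2)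
        (hr_lt _).le).trans hA
    have hB2 : ∫ z in closedBall (0 : ℂ) (r (5 * m + 2)), ‖iteratedFDeriv ℝ (m + 2 + 1) g z‖ ^ 2 ≤ Q₂ :=
      hBstep
    have hCstep : ∫ z in closedBall (0 : ℂ) (r (5 * m + 3)), ‖iteratedFDeriv ℝ (m + 2) g z‖ ^ 4 ≤ P := by
      refine (hCC g hg).trans ?_
      rw [hP]
      have hx : (∫ z in closedBall (0 : ℂ) (r (5 * m + 2)), ‖iteratedFDeriv ℝ (m + 2) g z‖ ^ 2) *
          ((∫ z in closedBall (0 : ℂ) (r (5 * m + 2)), ‖iteratedFDeriv ℝ (m + 2 + 1) g z‖ ^ 2) +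
            ∫ z in closedBall (0 : ℂ) (r (5 * m + 2)), ‖iteratedFDeriv ℝ (m + 2) g z‖ ^ 2) ≤
          Q₁ * (Q₂ + Q₁) :=
        mul_le_mul hA2 (add_le_add hB2 hA2) (add_nonneg (hnn _ _ _) (hnn _ _ _)) hQ₁0
      have hpos : 0 ≤ (∫ z in closedBall (0 : ℂ) (r (5 * m + 2)), ‖iteratedFDeriv ℝ (m + 2) g z‖ ^ 2) *
          ((∫ z in closedBall (0 : ℂ) (r (5 * m + 2)), ‖iteratedFDeriv ℝ (m + 2 + 1) g z‖ ^ 2) +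
            ∫ z in closedBall (0 : ℂ) (r (5 * m + 2)), ‖iteratedFDeriv ℝ (m + 2) g z‖ ^ 2) :=
        mul_nonneg (hnn _ _ _) (add_nonneg (hnn _ _ _) (hnn _ _ _))
      calc CC * _ ≤ |CC| * _ := mul_le_mul_of_nonneg_right (le_abs_self _) hpos
        _ ≤ _ := mul_le_mul_of_nonneg_left hx (abs_nonneg _)
    have hP0 : 0 ≤ P := (hnn _ _ _).trans hCstep
    -- step D
    have hDstep : ∫ z in closedBall (0 : ℂ) (r (5 * m + 4)), ‖iteratedFDeriv ℝ (m + 3 + 1) g z‖ ^ 2 ≤ Q₃ := by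
      have h := hCD g hg hgJ hg0 hg1 (fun i hi1 hi2 z hz =>
        hsup i (by omega) (5 * m + 3) (by omega) z (mem_closedBall_zero_iff.mpr hz))
      refine h.trans ?_
      rw [hQ₃]
      have hC3 : ∫ z in closedBall (0 : ℂ) (r (5 * m + 3)), ‖iteratedFDeriv ℝ (m + 3 - 1) g z‖ ^ 4 ≤ P :=
        hCstep
      have hB3 : ∫ z in closedBall (0 : ℂ) (r (5 * m + 3)), ‖iteratedFDeriv ℝ (m + 3) g z‖ ^ 2 ≤ Q₂ :=
        (setIntegral_closedBall_mono ((hac (m + 3)).pow 2) (fun z => pow_nonneg (norm_nonneg _) 2)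
          (hr_lt _).le).trans hBstep
      have hx4 := hnn (m + 3 - 1) 4 (r (5 * m + 3))
      have hx2 := hnn (m + 3) 2 (r (5 * m + 3))
      calc CD * _ ≤ |CD| * _ := mul_le_mul_of_nonneg_right (le_abs_self _) (by linarith)
        _ ≤ _ := mul_le_mul_of_nonneg_left (by linarith) (abs_nonneg _)
    -- step E
    have hEstep : ∀ z ∈ closedBall (0 : ℂ) (r (5 * m + 5)), ‖iteratedFDeriv ℝ (m + 2) g z‖ ≤
        |CE| * (1 + Q₃ + Q₂ + Q₁) := by
      intro z hz
      refine (hCE g hg z hz).trans ?_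
      have hD4 : ∫ z in closedBall (0 : ℂ) (r (5 * m + 4)), ‖iteratedFDeriv ℝ (m + 2 + 2) g z‖ ^ 2 ≤ Q₃ :=
        hDstep
      have hB4 : ∫ z in closedBall (0 : ℂ) (r (5 * m + 4)), ‖iteratedFDeriv ℝ (m + 2 + 1) g z‖ ^ 2 ≤ Q₂ :=
        (setIntegral_closedBall_mono ((hac (m + 2 + 1)).pow 2) (fun z => pow_nonneg (norm_nonneg _) 2)
          (hr_anti _ _ (by omega))).trans hBstep
      have hA4 : ∫ z in closedBall (0 : ℂ) (r (5 * m + 4)), ‖iteratedFDeriv ℝ (m + 2) g z‖ ^ 2 ≤ Q₁ :=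
        (setIntegral_closedBall_mono ((hac (m + 2)).pow 2) (fun z => pow_nonneg (norm_nonneg _) 2)
          (hr_anti _ _ (by omega))).trans hA
      have hx1 := hnn (m + 2 + 2) 2 (r (5 * m + 4))
      have hx2 := hnn (m + 2 + 1) 2 (r (5 * m + 4))
      have hx3 := hnn (m + 2) 2 (r (5 * m + 4))
      calc CE * _ ≤ |CE| * _ := mul_le_mul_of_nonneg_right (le_abs_self _) (by linarith)
        _ ≤ _ := mul_le_mul_of_nonneg_left (by linarith) (abs_nonneg _)
    -- conclusion
    have e5 : 5 * (m + 1) = 5 * m + 5 := by ring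
    rw [e5] at hz
    rcases Nat.lt_or_ge i (m + 2) with hlt | hge
    · exact (hsup i (by omega) (5 * m + 5) (by omega) z (mem_closedBall_zero_iff.mpr hz)).trans
        (le_max_left _ _)
    · have hi2 : i = m + 2 := by omega
      subst hi2
      exact (hEstep z (mem_closedBall_zero_iff.mpr hz)).trans (le_max_right _ _)

end Induction

end Apriori

end Literature.Geometry.Symplectic.JHolomorphicWeierstrassProof

/-!
## Part `SullivanDualWitnessChargeHelperFlatZalcman`:
### Flat Zalcman–Brody rescaling in a real normed space

Crux `WitnessCharge` (item stmt-SmoothPoincare4-7824, route route-SmoothPoincare4-SullivanDual),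
line `Sketch`, stub `helper_flatZalcman` ((P5)(B): when the gradients of pencil members blow up,
Zalcman–Brody rescaling produces a non-constant entire curve in a compact piece; after a Whitney
embedding the rescaling step is the flat lemma below, for maps into an arbitrary real normed
space `E`).

The elementary **Zalcman–Brody rescaling** of one `C¹` map `f : ℂ → E` with `f(D̄) ⊆ K` and
`df(0) ≠ 0` (L. Zalcman, *A heuristic principle in complex function theory*, Amer. Math. Monthly
82 (1975); R. Brody, *Compact manifolds and hyperbolicity*, Trans. AMS 235 (1978)).  Maximise the
weighted derivative `φ(ξ) = (1 - ‖ξ‖) ‖df(ξ)‖` over the closed unit disc (compact since `ℂ` is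
proper, and `φ` is continuous because `f` is `C¹`), say at `ξ₀`; put `a := 1 - ‖ξ₀‖`,
`D := ‖df(ξ₀)‖`, `M := a D ≥ φ(0) = ‖df(0)‖ > 0` (so `a > 0`, i.e. `‖ξ₀‖ < 1`, and `D > 0`),
`ρ := D⁻¹ > 0` and `g(ζ) := f(ξ₀ + ρ ζ)`.  By the chain rule `dg(ζ) = ρ • df(ξ₀ + ρ ζ)`, hence
`‖dg(0)‖ = ρ D = 1`.  For `‖ζ‖ ≤ M / 2` the point `ξ₀ + ρ ζ` has norm `≤ ‖ξ₀‖ + a / 2 ≤ 1`, so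
`g(ζ) ∈ K`, and `1 - ‖ξ₀ + ρ ζ‖ ≥ a / 2`, whence maximality of `φ` at `ξ₀` gives
`‖df(ξ₀ + ρ ζ)‖ ≤ 2 D`, i.e. `‖dg(ζ)‖ ≤ 2`.

Uses Mathlib (`IsCompact.exists_isMaxOn`, `isCompact_closedBall`, the chain rule) and the generic
affine-reparametrisation lemmas `Zalcman.norm_fderiv_comp_affine`
(`‖d(f(ξ + ρ ·))(ζ)‖ = ρ ‖df(ξ + ρ ζ)‖` for `ρ ≥ 0`) and `Zalcman.norm_affine_le` of the sibling
file `Summits/SmoothPoincare4/SmoothPoincare4/Theorems/SullivanDualTameOrBrodyR4StubZalcman.lean`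
(namespace `Literature.Geometry.Symplectic.JHolomorphicWeierstrassProof`), which proves the
same rescaling for `E = ℝ⁴` and `C^∞` flat-`J`-holomorphic maps.
-/

open Set Filter Topology Metric
open Literature.Geometry.Symplectic.JHolomorphicWeierstrassProof

namespace Literature.Geometry.Symplectic.JHolomorphicWeierstrassProof

variable {d : ℕ}
/-- **Zalcman–Brody rescaling in a real normed space.** A `C¹` map `f : ℂ → E` into a real
normed space, mapping the closed unit disc into `K` and with `df(0) ≠ 0`, admits a centre `ξ₀`
with `‖ξ₀‖ < 1`, a scale `ρ > 0` and a radius parameter `M ≥ ‖df(0)‖` such that the affine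
reparametrisation `g = f(ξ₀ + ρ ·)` is normalised by `‖dg(0)‖ = 1` and satisfies `g(ζ) ∈ K` and
`‖dg(ζ)‖ ≤ 2` on the disc `‖ζ‖ ≤ M / 2`.  Here `ξ₀` maximises `φ(ξ) = (1 - ‖ξ‖) ‖df(ξ)‖` over
the closed unit disc, `M = φ(ξ₀)` and `ρ = ‖df(ξ₀)‖⁻¹` (Zalcman 1975; Brody 1978). [folklore] -/
theorem helper_flatZalcman :
    ∀ {E : Type} [NormedAddCommGroup E] [NormedSpace ℝ E] (K : Set E) (f : ℂ → E),
      ContDiff ℝ 1 f → (∀ z : ℂ, ‖z‖ ≤ 1 → f z ∈ K) → fderiv ℝ f 0 ≠ 0 →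
      ∃ (ξ₀ : ℂ) (ρ M : ℝ), 0 < ρ ∧ ‖ξ₀‖ < 1 ∧ ‖fderiv ℝ f 0‖ ≤ M ∧
        (∀ ζ : ℂ, ‖ζ‖ ≤ M / 2 → f (ξ₀ + ρ • ζ) ∈ K) ∧
        ‖fderiv ℝ (fun ζ : ℂ => f (ξ₀ + ρ • ζ)) 0‖ = 1 ∧
        (∀ ζ : ℂ, ‖ζ‖ ≤ M / 2 → ‖fderiv ℝ (fun ζ : ℂ => f (ξ₀ + ρ • ζ)) ζ‖ ≤ 2) := by
  intro E _ _ K f hf hfK h0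
  have hdiff : Differentiable ℝ f := hf.differentiable one_ne_zero
  -- the weighted derivative `φ ξ = (1 - ‖ξ‖) ‖df ξ‖` is continuous; maximise it on the closed disc
  have hφc : Continuous fun ξ : ℂ => (1 - ‖ξ‖) * ‖fderiv ℝ f ξ‖ :=
    (continuous_const.sub continuous_norm).mul (hf.continuous_fderiv one_ne_zero).norm
  obtain ⟨ξ₀, hξ₀, hmax⟩ := (isCompact_closedBall (0 : ℂ) 1).exists_isMaxOn
    ⟨0, mem_closedBall_self zero_le_one⟩ hφc.continuousOn
  rw [isMaxOn_iff] at hmax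
  rw [mem_closedBall_zero_iff] at hξ₀
  -- abbreviations: `a = 1 - ‖ξ₀‖`, `D = ‖df ξ₀‖`, `M = a * D`, `ρ = D⁻¹`
  obtain ⟨a, ha⟩ : ∃ a : ℝ, a = 1 - ‖ξ₀‖ := ⟨_, rfl⟩
  obtain ⟨D, hD⟩ : ∃ D : ℝ, D = ‖fderiv ℝ f ξ₀‖ := ⟨_, rfl⟩
  have hmax' : ∀ w : ℂ, ‖w‖ ≤ 1 → (1 - ‖w‖) * ‖fderiv ℝ f w‖ ≤ a * D := fun w hw => by
    rw [ha, hD]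
    exact hmax w (mem_closedBall_zero_iff.mpr hw)
  have hM0 : ‖fderiv ℝ f 0‖ ≤ a * D := by
    have := hmax' 0 (by simp)
    simpa using this
  have hMpos : 0 < a * D := (norm_pos_iff.mpr h0).trans_le hM0
  have ha0 : 0 ≤ a := by rw [ha]; linarith
  have hD0 : 0 ≤ D := by rw [hD]; exact norm_nonneg _
  have hapos : 0 < a := lt_of_le_of_ne ha0 fun h => by
    rw [← h, zero_mul] at hMpos
    exact lt_irrefl 0 hMpos
  have hDpos : 0 < D := lt_of_le_of_ne hD0 fun h => by
    rw [← h, mul_zero] at hMpos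
    exact lt_irrefl 0 hMpos
  have hξ₀1 : ‖ξ₀‖ < 1 := by
    rw [ha] at hapos
    linarith
  obtain ⟨ρ, hρ⟩ : ∃ ρ : ℝ, ρ = D⁻¹ := ⟨_, rfl⟩
  have hρpos : 0 < ρ := by rw [hρ]; exact inv_pos.mpr hDpos
  have hρD : ρ * D = 1 := by rw [hρ]; exact inv_mul_cancel₀ hDpos.ne'
  have hρM : ρ * (a * D / 2) = a / 2 := by
    rw [hρ]
    field_simp
  -- the disc `‖ζ‖ ≤ M / 2` is mapped into the disc `‖ξ‖ ≤ ‖ξ₀‖ + a / 2 ≤ 1`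
  have hw : ∀ ζ : ℂ, ‖ζ‖ ≤ a * D / 2 → ‖ξ₀ + ρ • ζ‖ ≤ ‖ξ₀‖ + a / 2 := fun ζ hζ => by
    calc ‖ξ₀ + ρ • ζ‖ ≤ ‖ξ₀‖ + ρ * ‖ζ‖ := Zalcman.norm_affine_le ξ₀ ζ hρpos.le
      _ ≤ ‖ξ₀‖ + ρ * (a * D / 2) := by gcongr
      _ = ‖ξ₀‖ + a / 2 := by rw [hρM]
  have hw1 : ∀ ζ : ℂ, ‖ζ‖ ≤ a * D / 2 → ‖ξ₀ + ρ • ζ‖ ≤ 1 := fun ζ hζ => by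
    have := hw ζ hζ
    linarith
  refine ⟨ξ₀, ρ, a * D, hρpos, hξ₀1, hM0, fun ζ hζ => hfK _ (hw1 ζ hζ), ?_, fun ζ hζ => ?_⟩
  · -- `‖dg(0)‖ = ρ ‖df(ξ₀)‖ = 1`
    rw [Zalcman.norm_fderiv_comp_affine hdiff ξ₀ hρpos.le, smul_zero, add_zero, ← hD, hρD]
  · -- `‖dg(ζ)‖ = ρ ‖df(ξ₀ + ρ ζ)‖ ≤ ρ · 2 D = 2` by maximality of `φ` at `ξ₀`
    rw [Zalcman.norm_fderiv_comp_affine hdiff ξ₀ hρpos.le]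
    have h1 := hmax' _ (hw1 ζ hζ)
    have h2 : a / 2 ≤ 1 - ‖ξ₀ + ρ • ζ‖ := by
      have := hw ζ hζ
      linarith
    have h3 : a / 2 * ‖fderiv ℝ f (ξ₀ + ρ • ζ)‖ ≤ a / 2 * (2 * D) :=
      calc a / 2 * ‖fderiv ℝ f (ξ₀ + ρ • ζ)‖
          ≤ (1 - ‖ξ₀ + ρ • ζ‖) * ‖fderiv ℝ f (ξ₀ + ρ • ζ)‖ :=
            mul_le_mul_of_nonneg_right h2 (norm_nonneg _)
        _ ≤ a * D := h1
        _ = a / 2 * (2 * D) := by ring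
    have h4 : ‖fderiv ℝ f (ξ₀ + ρ • ζ)‖ ≤ 2 * D := le_of_mul_le_mul_left h3 (half_pos hapos)
    calc ρ * ‖fderiv ℝ f (ξ₀ + ρ • ζ)‖ ≤ ρ * (2 * D) := mul_le_mul_of_nonneg_left h4 hρpos.le
      _ = 2 := by rw [mul_left_comm, hρD, mul_one]

end Literature.Geometry.Symplectic.JHolomorphicWeierstrassProof

/-!
## Part `SullivanDualWitnessChargeHelperSmoothLimitLocal`:
### Local smooth limits under locally uniform derivative bounds

Helper file of the lead (c2) for line `Sketch` of the crux `WitnessCharge`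
(stmt-SmoothPoincare4-7824, route SullivanDual), registered stub `helper_smoothLimitLocal`.

Local form, on an open set `U ⊆ ℂ`, of the landed global lemma `stub_smoothLimit`
(`SullivanDualTameOrBrodyR4StubSmoothLimit`): if maps `u n : ℂ → ℝ⁴` are `C^∞` on `U`, all their
derivatives are bounded on every compact subset of `U` uniformly in `n`, and `u n → v` locally
uniformly on `U`, then `v` is `C^∞` on `U` and `d(u n) → dv` locally uniformly on `U`.

Proof by cut-off: around `z₀ ∈ U` take a smooth bump `χ : ContDiffBump z₀` with
`tsupport χ = closedBall z₀ χ.rOut ⊆ U`. The maps `χ • u n`, `χ • v` are `C^∞` on all of `ℂ`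
(products of smooth maps near points of `U`, locally zero off `tsupport χ`), the derivatives of
`χ • u n` are bounded on `ℂ` uniformly in `n` (Leibniz bound `norm_iteratedFDerivWithin_smul_le`
on `tsupport χ`, zero outside), and `χ • u n → χ • v` locally uniformly on `ℂ` (`0 ≤ χ ≤ 1`).
Hence `stub_smoothLimit` applies to the cut-offs, and on `ball z₀ χ.rIn`, where `χ ≡ 1` near
every point, its two conclusions transfer back to `u n` and `v`.
-/

open scoped ContDiff Topology Nat
open Filter Set Metric
open Literature.Geometry.Symplectic.JHolomorphicWeierstrassProof

namespace Literature.Geometry.Symplectic.JHolomorphicWeierstrassProof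

variable {d : ℕ}
namespace SmoothLimitLocal

variable {F : Type*} [NormedAddCommGroup F] [NormedSpace ℝ F]

/-- Off the topological support of the bump `χ`, every cut-off `χ • w` vanishes near the point. [folklore] -/
theorem cutoff_eventuallyEq_zero {z₀ z : ℂ} (χ : ContDiffBump z₀) (hz : z ∉ tsupport χ)
    (w : ℂ → F) : (fun y => χ y • w y) =ᶠ[𝓝 z] fun _ => 0 := by
  filter_upwards [notMem_tsupport_iff_eventuallyEq.mp hz] with y hy
  simp [hy]

/-- On the inner ball of the bump `χ`, every cut-off `χ • w` agrees with `w` near the point. [folklore] -/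
theorem cutoff_eventuallyEq {z₀ z : ℂ} (χ : ContDiffBump z₀) (hz : z ∈ ball z₀ χ.rIn)
    (w : ℂ → F) : (fun y => χ y • w y) =ᶠ[𝓝 z] w := by
  filter_upwards [χ.eventuallyEq_one_of_mem_ball hz] with y hy
  simp [hy]

/-- The cut-off by `χ` of a map that is `C^∞` on an open set `U ⊇ tsupport χ` is `C^∞` on `ℂ`. [folklore] -/
theorem cutoff_contDiff {U : Set ℂ} (hU : IsOpen U) {z₀ : ℂ} (χ : ContDiffBump z₀)
    (hχU : tsupport χ ⊆ U) {w : ℂ → F} (hw : ContDiffOn ℝ ∞ w U) :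
    ContDiff ℝ ∞ fun y => χ y • w y :=
  contDiff_iff_contDiffAt.2 fun z => by
    by_cases hz : z ∈ U
    · exact χ.contDiffAt.smul (hw.contDiffAt (hU.mem_nhds hz))
    · exact contDiffAt_const.congr_of_eventuallyEq
        (cutoff_eventuallyEq_zero χ (fun h => hz (hχU h)) w)

/-- The derivatives of every order of the cut-offs `χ • u n` are bounded on `ℂ`, uniformly in `n`,
as soon as those of `u n` are bounded on the compact set `tsupport χ ⊆ U` uniformly in `n`. [folklore] -/
theorem cutoff_bound {U : Set ℂ} (hU : IsOpen U) {u : ℕ → ℂ → F}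
    (hu : ∀ n, ContDiffOn ℝ ∞ (u n) U)
    (hb : ∀ (k : ℕ) (K : Set ℂ), IsCompact K → K ⊆ U →
      ∃ C : ℝ, ∀ n, ∀ z ∈ K, ‖iteratedFDeriv ℝ k (u n) z‖ ≤ C)
    {z₀ : ℂ} (χ : ContDiffBump z₀) (hχU : tsupport χ ⊆ U) (k : ℕ) :
    ∃ C : ℝ, ∀ n z, ‖iteratedFDeriv ℝ k (fun y => χ y • u n y) z‖ ≤ C := by
  have hK : IsCompact (tsupport χ) := χ.hasCompactSupport
  -- bounds for the derivatives of `χ` and of the `u n` on `tsupport χ`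
  have hA : ∀ i : ℕ, ∃ A : ℝ, ∀ z ∈ tsupport χ, ‖iteratedFDeriv ℝ i χ z‖ ≤ A := fun i =>
    hK.exists_bound_of_continuousOn
      ((χ.contDiff (n := i)).continuous_iteratedFDeriv (mod_cast le_rfl)).continuousOn
  choose A hA using hA
  have hB : ∀ j : ℕ, ∃ B : ℝ, ∀ n, ∀ z ∈ tsupport χ, ‖iteratedFDeriv ℝ j (u n) z‖ ≤ B :=
    fun j => hb j _ hK hχU
  choose B hB using hB
  have hz₀ : z₀ ∈ tsupport χ := by
    rw [χ.tsupport_eq]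
    exact mem_closedBall_self χ.rOut_pos.le
  have hA0 : ∀ i, 0 ≤ A i := fun i => (norm_nonneg _).trans (hA i z₀ hz₀)
  have hB0 : ∀ j, 0 ≤ B j := fun j => (norm_nonneg _).trans (hB j 0 z₀ hz₀)
  refine ⟨∑ i ∈ Finset.range (k + 1), (k.choose i : ℝ) * A i * B (k - i), fun n z => ?_⟩
  by_cases hz : z ∈ tsupport χ
  · -- Leibniz bound on the open set `U ∋ z`
    have hzU : z ∈ U := hχU hz
    rw [← iteratedFDerivWithin_of_isOpen k hU hzU]
    calc ‖iteratedFDerivWithin ℝ k (fun y => χ y • u n y) U z‖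
        ≤ ∑ i ∈ Finset.range (k + 1), (k.choose i : ℝ) * ‖iteratedFDerivWithin ℝ i χ U z‖ *
            ‖iteratedFDerivWithin ℝ (k - i) (u n) U z‖ :=
          norm_iteratedFDerivWithin_smul_le χ.contDiff.contDiffOn (hu n) hU.uniqueDiffOn hzU
            (mod_cast le_top)
      _ ≤ ∑ i ∈ Finset.range (k + 1), (k.choose i : ℝ) * A i * B (k - i) := by
          refine Finset.sum_le_sum fun i _ => ?_
          rw [iteratedFDerivWithin_of_isOpen i hU hzU,
            iteratedFDerivWithin_of_isOpen (k - i) hU hzU]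
          exact mul_le_mul (mul_le_mul_of_nonneg_left (hA i z hz) (Nat.cast_nonneg _))
            (hB (k - i) n z hz) (norm_nonneg _) (mul_nonneg (Nat.cast_nonneg _) (hA0 i))
  · -- off `tsupport χ` the cut-off vanishes near `z`
    rw [((cutoff_eventuallyEq_zero χ hz (u n)).iteratedFDeriv ℝ k).eq_of_nhds,
      iteratedFDeriv_fun_zero, Pi.zero_apply, norm_zero]
    exact Finset.sum_nonneg fun i _ =>
      mul_nonneg (mul_nonneg (Nat.cast_nonneg _) (hA0 i)) (hB0 _)

/-- The cut-offs `χ • u n` converge to `χ • v` locally uniformly on `ℂ` as soon as `u n → v`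
locally uniformly on an open set `U ⊇ tsupport χ`. [folklore] -/
theorem cutoff_tendsto {U : Set ℂ} (hU : IsOpen U) {u : ℕ → ℂ → F} {v : ℂ → F}
    (hlim : TendstoLocallyUniformlyOn u v atTop U) {z₀ : ℂ} (χ : ContDiffBump z₀)
    (hχU : tsupport χ ⊆ U) :
    TendstoLocallyUniformly (fun n y => χ y • u n y) (fun y => χ y • v y) atTop := by
  rw [Metric.tendstoLocallyUniformly_iff]
  intro ε hε x
  by_cases hx : x ∈ U
  · obtain ⟨t, ht, hev⟩ := Metric.tendstoLocallyUniformlyOn_iff.mp hlim ε hε x hx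
    rw [hU.nhdsWithin_eq hx] at ht
    refine ⟨t, ht, hev.mono fun n hn y hy => ?_⟩
    calc dist (χ y • v y) (χ y • u n y) = χ y * dist (v y) (u n y) := by
          rw [dist_smul₀, Real.norm_of_nonneg χ.nonneg]
      _ ≤ 1 * dist (v y) (u n y) := by gcongr; exact χ.le_one
      _ < ε := by rw [one_mul]; exact hn y hy
  · refine ⟨(tsupport χ)ᶜ, (isClosed_tsupport χ).isOpen_compl.mem_nhds fun h => hx (hχU h),
      Eventually.of_forall fun n y hy => ?_⟩
    rw [image_eq_zero_of_notMem_tsupport hy, zero_smul, zero_smul, dist_self]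
    exact hε

/-- The local conclusion on the inner ball of a bump `χ` with `tsupport χ ⊆ U`: `v` is `C^∞` on
`ball z₀ χ.rIn` and `d(u n) → dv` locally uniformly there (`stub_smoothLimit` for the cut-offs,
transferred back through `χ ≡ 1` near each point of the ball). [folklore] -/
theorem smoothLimit_ball {U : Set ℂ} (hU : IsOpen U) {u : ℕ → ℂ → EuclideanSpace ℝ (Fin d)}
    {v : ℂ → EuclideanSpace ℝ (Fin d)} (hu : ∀ n, ContDiffOn ℝ ∞ (u n) U)
    (hb : ∀ (k : ℕ) (K : Set ℂ), IsCompact K → K ⊆ U →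
      ∃ C : ℝ, ∀ n, ∀ z ∈ K, ‖iteratedFDeriv ℝ k (u n) z‖ ≤ C)
    (hlim : TendstoLocallyUniformlyOn u v atTop U) {z₀ : ℂ} (χ : ContDiffBump z₀)
    (hχU : tsupport χ ⊆ U) :
    ContDiffOn ℝ ∞ v (ball z₀ χ.rIn) ∧
      TendstoLocallyUniformlyOn (fun n => fderiv ℝ (u n)) (fderiv ℝ v) atTop (ball z₀ χ.rIn) := by
  obtain ⟨hv, hder⟩ := stub_smoothLimit (fun n y => χ y • u n y) (fun y => χ y • v y)
    (fun n => cutoff_contDiff hU χ hχU (hu n))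
    (fun k _ => (cutoff_bound hU hu hb χ hχU k).imp fun C hC n z _ => hC n z)
    (cutoff_tendsto hU hlim χ hχU)
  refine ⟨fun z hz => ?_, ?_⟩
  · exact (hv.contDiffAt.congr_of_eventuallyEq (cutoff_eventuallyEq χ hz v).symm).contDiffWithinAt
  · refine ((hder.tendstoLocallyUniformlyOn (s := ball z₀ χ.rIn)).congr
      fun n z hz => ?_).congr_right fun z hz => ?_
    · exact (cutoff_eventuallyEq χ hz (u n)).fderiv_eq
    · exact (cutoff_eventuallyEq χ hz v).fderiv_eq

end SmoothLimitLocal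

/-- **Local smooth limits (stub A3 of line `Sketch`).** On an open `U ⊆ ℂ`: maps `C^∞` on `U`
with all derivatives bounded uniformly in `n` on every compact subset of `U`, converging locally
uniformly on `U`, have a limit that is `C^∞` on `U`, and the first derivatives converge locally
uniformly on `U` (local form of the landed `stub_smoothLimit`, by cut-off). [folklore] -/
theorem helper_smoothLimitLocal :
    ∀ (U : Set ℂ), IsOpen U → ∀ (u : ℕ → ℂ → EuclideanSpace ℝ (Fin d))
      (v : ℂ → EuclideanSpace ℝ (Fin d)), (∀ n, ContDiffOn ℝ ∞ (u n) U) →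
      (∀ (k : ℕ) (K : Set ℂ), IsCompact K → K ⊆ U →
        ∃ C : ℝ, ∀ n, ∀ z ∈ K, ‖iteratedFDeriv ℝ k (u n) z‖ ≤ C) →
      TendstoLocallyUniformlyOn u v atTop U →
      ContDiffOn ℝ ∞ v U ∧
        TendstoLocallyUniformlyOn (fun n => fderiv ℝ (u n)) (fderiv ℝ v) atTop U := by
  intro U hU u v hu hb hlim
  -- a smooth bump around each point of `U`, supported in `U`
  have hχ : ∀ z₀ ∈ U, ∃ χ : ContDiffBump z₀, tsupport χ ⊆ U := fun z₀ hz₀ => by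
    obtain ⟨R, hR, hRU⟩ := Metric.isOpen_iff.mp hU z₀ hz₀
    refine ⟨⟨R / 4, R / 2, by linarith, by linarith⟩, ?_⟩
    rw [ContDiffBump.tsupport_eq]
    exact (closedBall_subset_ball (show R / 2 < R by linarith)).trans hRU
  refine ⟨fun z₀ hz₀ => ?_, fun e he z₀ hz₀ => ?_⟩
  · obtain ⟨χ, hχU⟩ := hχ z₀ hz₀
    exact ((SmoothLimitLocal.smoothLimit_ball hU hu hb hlim χ hχU).1.contDiffAt
      (ball_mem_nhds z₀ χ.rIn_pos)).contDiffWithinAt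
  · obtain ⟨χ, hχU⟩ := hχ z₀ hz₀
    obtain ⟨t, ht, hev⟩ :=
      (SmoothLimitLocal.smoothLimit_ball hU hu hb hlim χ hχU).2 e he z₀ (mem_ball_self χ.rIn_pos)
    rw [isOpen_ball.nhdsWithin_eq (mem_ball_self χ.rIn_pos)] at ht
    exact ⟨t, mem_nhdsWithin_of_mem_nhds ht, hev⟩

end Literature.Geometry.Symplectic.JHolomorphicWeierstrassProof

/-!
## Part `SullivanDualWitnessChargeHelperGradBoundOfC0Aux`:
### Auxiliary lemmas for `helper_gradBoundOfC0_of` (Zalcman upgrade), crux `WitnessCharge`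
(item stmt-SmoothPoincare4-7824, route `SullivanDual`, line `Sketch`; registered stub of this
file: `helper_gradBoundOfC0_zalcman`)

Generic (target a real normed space `E`) ingredients of the Zalcman–Brody blow-up argument
proving that `C⁰_loc` convergence of flat-`J`-holomorphic maps forces local gradient bounds:

* local chain rule for real affine reparametrisations `η ↦ f (ξ + ρ • η)` of the source
  (`GradBound.hasFDerivAt_comp_affine` and consequences; flat `J`-holomorphicity on an open set is
  preserved, `GradBound.jHol_comp_affine`);
* **Zalcman–Brody rescaling with domain control** (`helper_gradBoundOfC0_zalcman`): the proof of
  the landed `helper_flatZalcman` (L. Zalcman, Amer. Math. Monthly 82 (1975); R. Brody, Trans. AMS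
  235 (1978)) for maps that are only `C¹` on the disc `‖z‖ < 2`, recording moreover that
  `ρ M ≤ 1` and that the disc `‖ζ‖ ≤ M / 2` is mapped by `ζ ↦ ξ₀ + ρ ζ` into the disc of radius
  `(1 + ‖ξ₀‖) / 2 < 1`;
* uniform bounds for uniformly convergent sequences of continuous functions on compact sets,
  reindexing along `n_j → ∞`, and uniform convergence TO A CONSTANT of shrinking rescalings
  `ζ ↦ F k (q k + t k • ζ)` (`t k → 0`, `q k → q⋆`) of a uniformly convergent sequence.
-/

open scoped ContDiff Topology
open Filter Set Metric
open Literature.Geometry.Symplectic.JHolomorphicWeierstrassProof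

namespace Literature.Geometry.Symplectic.JHolomorphicWeierstrassProof

variable {d : ℕ}
section Affine

variable {E : Type*} [NormedAddCommGroup E] [NormedSpace ℝ E]

/-- Local chain rule for a real affine reparametrisation of the source: if `f` is differentiable
at `ξ + ρ • ζ`, then `η ↦ f (ξ + ρ • η)` has derivative `ρ • df(ξ + ρ • ζ)` at `ζ`. [folklore] -/
theorem GradBound.hasFDerivAt_comp_affine {f : ℂ → E} {ξ : ℂ} {ρ : ℝ} {ζ : ℂ}
    (hf : DifferentiableAt ℝ f (ξ + ρ • ζ)) :
    HasFDerivAt (fun η : ℂ => f (ξ + ρ • η)) (ρ • fderiv ℝ f (ξ + ρ • ζ)) ζ := by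
  have haff : HasFDerivAt (fun η : ℂ => ξ + ρ • η) (ρ • ContinuousLinearMap.id ℝ ℂ) ζ :=
    ((hasFDerivAt_id ζ).const_smul ρ).const_add ξ
  have hlin : (fderiv ℝ f (ξ + ρ • ζ)).comp (ρ • ContinuousLinearMap.id ℝ ℂ) =
      ρ • fderiv ℝ f (ξ + ρ • ζ) := by
    ext η
    simp
  have hcomp := hf.hasFDerivAt.comp ζ haff
  rw [hlin] at hcomp
  exact hcomp

/-- Local form of the derivative of the affine reparametrisation `η ↦ f (ξ + ρ • η)`. [folklore] -/
theorem GradBound.fderiv_comp_affine {f : ℂ → E} {ξ : ℂ} {ρ : ℝ} {ζ : ℂ}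
    (hf : DifferentiableAt ℝ f (ξ + ρ • ζ)) :
    fderiv ℝ (fun η : ℂ => f (ξ + ρ • η)) ζ = ρ • fderiv ℝ f (ξ + ρ • ζ) :=
  (GradBound.hasFDerivAt_comp_affine hf).fderiv

/-- Local form of the norm of the derivative of the affine reparametrisation, for `ρ ≥ 0`. [folklore] -/
theorem GradBound.norm_fderiv_comp_affine {f : ℂ → E} {ξ : ℂ} {ρ : ℝ} {ζ : ℂ}
    (hf : DifferentiableAt ℝ f (ξ + ρ • ζ)) (hρ : 0 ≤ ρ) :
    ‖fderiv ℝ (fun η : ℂ => f (ξ + ρ • η)) ζ‖ = ρ * ‖fderiv ℝ f (ξ + ρ • ζ)‖ := by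
  rw [GradBound.fderiv_comp_affine hf, norm_smul, Real.norm_of_nonneg hρ]

/-- An affine reparametrisation of a map that is `C^N` on `U` is `C^N` on every set mapped into
`U`. [folklore] -/
theorem GradBound.contDiffOn_comp_affine {u : ℂ → E} {U V : Set ℂ} {N : WithTop ℕ∞}
    (hu : ContDiffOn ℝ N u U) (c : ℂ) (t : ℝ) (hV : MapsTo (fun η : ℂ => c + t • η) V U) :
    ContDiffOn ℝ N (fun η : ℂ => u (c + t • η)) V :=
  hu.comp (contDiff_const.add (contDiff_const_smul t)).contDiffOn hV

/-- Derivative of an affine reparametrisation of a map differentiable on an open `U`, at a point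
mapped into `U`. [folklore] -/
theorem GradBound.fderiv_comp_affine_of_mem {u : ℂ → E} {U : Set ℂ} (hU : IsOpen U)
    (hu : DifferentiableOn ℝ u U) (c : ℂ) (t : ℝ) {η : ℂ} (hη : c + t • η ∈ U) :
    fderiv ℝ (fun θ : ℂ => u (c + t • θ)) η = t • fderiv ℝ u (c + t • η) :=
  GradBound.fderiv_comp_affine (hu.differentiableAt (hU.mem_nhds hη))

/-- A real affine reparametrisation of the source preserves flat `J`-holomorphicity (each `J x`
is linear, so it commutes with the real scalar `t`). [folklore] -/
theorem GradBound.jHol_comp_affine {J : E → E →L[ℝ] E} {u : ℂ → E} {U V : Set ℂ}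
    (hU : IsOpen U) (hu : DifferentiableOn ℝ u U)
    (huJ : ∀ z ∈ U, ∀ ζ : ℂ, fderiv ℝ u z (Complex.I * ζ) = J (u z) (fderiv ℝ u z ζ))
    (c : ℂ) (t : ℝ) (hV : MapsTo (fun η : ℂ => c + t • η) V U) :
    ∀ η ∈ V, ∀ ζ : ℂ, fderiv ℝ (fun θ : ℂ => u (c + t • θ)) η (Complex.I * ζ) =
      J (u (c + t • η)) (fderiv ℝ (fun θ : ℂ => u (c + t • θ)) η ζ) := by
  intro η hη ζ
  rw [GradBound.fderiv_comp_affine_of_mem hU hu c t (hV hη), smul_apply, smul_apply, huJ _ (hV hη),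
    (J _).map_smul]

end Affine

/-- **Zalcman–Brody rescaling with domain control.** A map `f : ℂ → E` into a real normed space,
`C¹` on the disc `‖z‖ < 2` and with `df(0) ≠ 0`, admits a centre `ξ₀` with `‖ξ₀‖ < 1`, a scale
`ρ > 0` and a radius parameter `M ≥ ‖df(0)‖` with `ρ M ≤ 1` such that the affine
reparametrisation `g = f(ξ₀ + ρ ·)` is normalised by `‖dg(0)‖ = 1`, satisfies `‖dg(ζ)‖ ≤ 2` on the
disc `‖ζ‖ ≤ M / 2`, and this disc is mapped by `ζ ↦ ξ₀ + ρ ζ` into the disc of radius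
`(1 + ‖ξ₀‖) / 2 < 1`.  Here `ξ₀` maximises `φ(ξ) = (1 - ‖ξ‖) ‖df(ξ)‖` over the closed unit disc,
`M = φ(ξ₀)` and `ρ = ‖df(ξ₀)‖⁻¹` (Zalcman 1975; Brody 1978); the proof is that of
`helper_flatZalcman`, recording the two extra pieces of information. [folklore] -/
theorem helper_gradBoundOfC0_zalcman :
    ∀ {E : Type} [NormedAddCommGroup E] [NormedSpace ℝ E] (f : ℂ → E),
      ContDiffOn ℝ 1 f (Metric.ball 0 2) → fderiv ℝ f 0 ≠ 0 →
      ∃ (ξ₀ : ℂ) (ρ M : ℝ), 0 < ρ ∧ ‖ξ₀‖ < 1 ∧ ‖fderiv ℝ f 0‖ ≤ M ∧ ρ * M ≤ 1 ∧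
        (∀ ζ : ℂ, ‖ζ‖ ≤ M / 2 → ‖ξ₀ + ρ • ζ‖ ≤ (1 + ‖ξ₀‖) / 2) ∧
        ‖fderiv ℝ (fun ζ : ℂ => f (ξ₀ + ρ • ζ)) 0‖ = 1 ∧
        (∀ ζ : ℂ, ‖ζ‖ ≤ M / 2 → ‖fderiv ℝ (fun ζ : ℂ => f (ξ₀ + ρ • ζ)) ζ‖ ≤ 2) := by
  intro E _ _ f hf h0
  have hsub : closedBall (0 : ℂ) 1 ⊆ ball 0 2 := closedBall_subset_ball (by norm_num)
  have hdiff : ∀ w : ℂ, ‖w‖ ≤ 1 → DifferentiableAt ℝ f w := fun w hw =>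
    (hf.differentiableOn one_ne_zero).differentiableAt
      (isOpen_ball.mem_nhds (hsub (mem_closedBall_zero_iff.mpr hw)))
  -- the weighted derivative `φ ξ = (1 - ‖ξ‖) ‖df ξ‖` is continuous on the closed disc; maximise it
  have hφc : ContinuousOn (fun ξ : ℂ => (1 - ‖ξ‖) * ‖fderiv ℝ f ξ‖) (closedBall 0 1) :=
    (continuous_const.sub continuous_norm).continuousOn.mul
      ((hf.continuousOn_fderiv_of_isOpen isOpen_ball le_rfl).mono hsub).norm
  obtain ⟨ξ₀, hξ₀, hmax⟩ := (isCompact_closedBall (0 : ℂ) 1).exists_isMaxOn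
    ⟨0, mem_closedBall_self zero_le_one⟩ hφc
  rw [isMaxOn_iff] at hmax
  rw [mem_closedBall_zero_iff] at hξ₀
  -- abbreviations: `a = 1 - ‖ξ₀‖`, `D = ‖df ξ₀‖`, `M = a * D`, `ρ = D⁻¹`
  obtain ⟨a, ha⟩ : ∃ a : ℝ, a = 1 - ‖ξ₀‖ := ⟨_, rfl⟩
  obtain ⟨D, hD⟩ : ∃ D : ℝ, D = ‖fderiv ℝ f ξ₀‖ := ⟨_, rfl⟩
  have hmax' : ∀ w : ℂ, ‖w‖ ≤ 1 → (1 - ‖w‖) * ‖fderiv ℝ f w‖ ≤ a * D := fun w hw => by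
    rw [ha, hD]
    exact hmax w (mem_closedBall_zero_iff.mpr hw)
  have hM0 : ‖fderiv ℝ f 0‖ ≤ a * D := by
    have := hmax' 0 (by simp)
    simpa using this
  have hMpos : 0 < a * D := (norm_pos_iff.mpr h0).trans_le hM0
  have ha0 : 0 ≤ a := by rw [ha]; linarith
  have hD0 : 0 ≤ D := by rw [hD]; exact norm_nonneg _
  have hapos : 0 < a := lt_of_le_of_ne ha0 fun h => by
    rw [← h, zero_mul] at hMpos
    exact lt_irrefl 0 hMpos
  have hDpos : 0 < D := lt_of_le_of_ne hD0 fun h => by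
    rw [← h, mul_zero] at hMpos
    exact lt_irrefl 0 hMpos
  have hξ₀1 : ‖ξ₀‖ < 1 := by
    rw [ha] at hapos
    linarith
  obtain ⟨ρ, hρ⟩ : ∃ ρ : ℝ, ρ = D⁻¹ := ⟨_, rfl⟩
  have hρpos : 0 < ρ := by rw [hρ]; exact inv_pos.mpr hDpos
  have hρD : ρ * D = 1 := by rw [hρ]; exact inv_mul_cancel₀ hDpos.ne'
  have hρM : ρ * (a * D / 2) = a / 2 := by
    rw [hρ]
    field_simp
  have hρM1 : ρ * (a * D) ≤ 1 :=
    calc ρ * (a * D) = a * (ρ * D) := by ring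
      _ = a := by rw [hρD, mul_one]
      _ ≤ 1 := by rw [ha]; linarith [norm_nonneg ξ₀]
  -- the disc `‖ζ‖ ≤ M / 2` is mapped into the disc `‖ξ‖ ≤ ‖ξ₀‖ + a / 2 = (1 + ‖ξ₀‖) / 2 < 1`
  have hw : ∀ ζ : ℂ, ‖ζ‖ ≤ a * D / 2 → ‖ξ₀ + ρ • ζ‖ ≤ ‖ξ₀‖ + a / 2 := fun ζ hζ => by
    calc ‖ξ₀ + ρ • ζ‖ ≤ ‖ξ₀‖ + ρ * ‖ζ‖ := Zalcman.norm_affine_le ξ₀ ζ hρpos.le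
      _ ≤ ‖ξ₀‖ + ρ * (a * D / 2) := by gcongr
      _ = ‖ξ₀‖ + a / 2 := by rw [hρM]
  have hw1 : ∀ ζ : ℂ, ‖ζ‖ ≤ a * D / 2 → ‖ξ₀ + ρ • ζ‖ ≤ 1 := fun ζ hζ => by
    have := hw ζ hζ
    linarith
  have hw2 : ∀ ζ : ℂ, ‖ζ‖ ≤ a * D / 2 → ‖ξ₀ + ρ • ζ‖ ≤ (1 + ‖ξ₀‖) / 2 := fun ζ hζ => by
    have := hw ζ hζ
    rw [ha] at this
    linarith
  refine ⟨ξ₀, ρ, a * D, hρpos, hξ₀1, hM0, hρM1, hw2, ?_, fun ζ hζ => ?_⟩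
  · -- `‖dg(0)‖ = ρ ‖df(ξ₀)‖ = 1`
    have h00 : ‖ξ₀ + ρ • (0 : ℂ)‖ ≤ 1 := by
      rw [smul_zero, add_zero]
      exact hξ₀1.le
    rw [GradBound.norm_fderiv_comp_affine (hdiff _ h00) hρpos.le, smul_zero, add_zero, ← hD, hρD]
  · -- `‖dg(ζ)‖ = ρ ‖df(ξ₀ + ρ ζ)‖ ≤ ρ · 2 D = 2` by maximality of `φ` at `ξ₀`
    rw [GradBound.norm_fderiv_comp_affine (hdiff _ (hw1 ζ hζ)) hρpos.le]
    have h1 := hmax' _ (hw1 ζ hζ)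
    have h2 : a / 2 ≤ 1 - ‖ξ₀ + ρ • ζ‖ := by
      have := hw ζ hζ
      linarith
    have h3 : a / 2 * ‖fderiv ℝ f (ξ₀ + ρ • ζ)‖ ≤ a / 2 * (2 * D) :=
      calc a / 2 * ‖fderiv ℝ f (ξ₀ + ρ • ζ)‖
          ≤ (1 - ‖ξ₀ + ρ • ζ‖) * ‖fderiv ℝ f (ξ₀ + ρ • ζ)‖ :=
            mul_le_mul_of_nonneg_right h2 (norm_nonneg _)
        _ ≤ a * D := h1
        _ = a / 2 * (2 * D) := by ring
    have h4 : ‖fderiv ℝ f (ξ₀ + ρ • ζ)‖ ≤ 2 * D := le_of_mul_le_mul_left h3 (half_pos hapos)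
    calc ρ * ‖fderiv ℝ f (ξ₀ + ρ • ζ)‖ ≤ ρ * (2 * D) := mul_le_mul_of_nonneg_left h4 hρpos.le
      _ = 2 := by rw [mul_left_comm, hρD, mul_one]

section Limits

variable {X E : Type*} [NormedAddCommGroup E]

/-- Finitely many individually bounded real functions on a set are uniformly bounded there. [folklore] -/
theorem GradBound.exists_bound_head {S : Set X} (b : ℕ → X → ℝ)
    (hb : ∀ m, ∃ B : ℝ, ∀ x ∈ S, b m x ≤ B) (N : ℕ) :
    ∃ B : ℝ, ∀ m ≤ N, ∀ x ∈ S, b m x ≤ B := by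
  induction N with
  | zero =>
    obtain ⟨B, hB⟩ := hb 0
    exact ⟨B, fun m hm x hx => by rw [Nat.le_zero.mp hm]; exact hB x hx⟩
  | succ N ih =>
    obtain ⟨B, hB⟩ := ih
    obtain ⟨B', hB'⟩ := hb (N + 1)
    refine ⟨max B B', fun m hm x hx => ?_⟩
    rcases Nat.le_succ_iff.mp hm with h | h
    · exact (hB m h x hx).trans (le_max_left _ _)
    · rw [h]
      exact (hB' x hx).trans (le_max_right _ _)

/-- Functions continuous on a compact set and converging uniformly there are uniformly bounded
there (tail: uniform closeness to the continuous, hence bounded, limit; head: finitely many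
bounded functions). [folklore] -/
theorem GradBound.exists_bound_of_tendstoUniformlyOn [TopologicalSpace X] {S : Set X}
    (hS : IsCompact S) {F : ℕ → X → E} {f : X → E} (hF : ∀ n, ContinuousOn (F n) S)
    (h : TendstoUniformlyOn F f atTop S) : ∃ R : ℝ, ∀ n, ∀ x ∈ S, ‖F n x‖ ≤ R := by
  have hf : ContinuousOn f S := h.continuousOn (Frequently.of_forall hF)
  obtain ⟨B, hB⟩ := hS.exists_bound_of_continuousOn hf
  obtain ⟨N, hN⟩ := eventually_atTop.mp ((Metric.tendstoUniformlyOn_iff.mp h) 1 one_pos)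
  obtain ⟨B', hB'⟩ := GradBound.exists_bound_head (fun n x => ‖F n x‖)
    (fun n => hS.exists_bound_of_continuousOn (hF n)) N
  refine ⟨max (B + 1) B', fun n x hx => ?_⟩
  rcases le_or_gt n N with hn | hn
  · exact (hB' n hn x hx).trans (le_max_right _ _)
  · have h1 : dist (F n x) (f x) ≤ 1 := by
      rw [dist_comm]
      exact (hN n hn.le x hx).le
    have h2 : ‖F n x‖ ≤ ‖f x‖ + 1 := norm_le_norm_add_const_of_dist_le h1
    exact (h2.trans (by linarith [hB x hx])).trans (le_max_left _ _)

/-- Reindexing a uniformly convergent sequence of functions along indices tending to infinity —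
Mathlib's `TendstoUniformlyOn.seq_tendstoUniformlyOn`; kept as a deprecated restatement
(dedup-02770). [folklore] -/
@[deprecated TendstoUniformlyOn.seq_tendstoUniformlyOn (since := "2026-08-17")]
theorem GradBound.tendstoUniformlyOn_comp [PseudoMetricSpace X] {Y : Type*} {S : Set Y}
    {F : ℕ → Y → X} {f : Y → X} (h : TendstoUniformlyOn F f atTop S) {n : ℕ → ℕ}
    (hn : Tendsto n atTop atTop) : TendstoUniformlyOn (fun j => F (n j)) f atTop S :=
  h.seq_tendstoUniformlyOn n hn

/-- **Shrinking rescalings converge uniformly to a constant.** If `F k → v` uniformly on a compact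
`S ⊆ ℂ` with `v` continuous on `S`, `q k → q⋆ ∈ S` and `t k → 0`, and the affine images
`q k + t k • ζ`, `‖ζ‖ < 1`, stay in `S`, then `ζ ↦ F k (q k + t k • ζ)` converges to the constant
`v q⋆` uniformly on the open unit disc. [folklore] -/
theorem GradBound.tendstoUniformlyOn_const {S : Set ℂ} (hS : IsCompact S) {F : ℕ → ℂ → E}
    {v : ℂ → E} (hv : ContinuousOn v S) (hF : TendstoUniformlyOn F v atTop S) {q : ℕ → ℂ}
    {qs : ℂ} (hq : Tendsto q atTop (𝓝 qs)) (hqs : qs ∈ S) {t : ℕ → ℝ}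
    (ht : Tendsto t atTop (𝓝 0)) (hmem : ∀ k (ζ : ℂ), ‖ζ‖ < 1 → q k + t k • ζ ∈ S) :
    TendstoUniformlyOn (fun k ζ => F k (q k + t k • ζ)) (fun _ => v qs) atTop (ball 0 1) := by
  rw [Metric.tendstoUniformlyOn_iff] at hF ⊢
  intro ε hε
  obtain ⟨η, hη, hvη⟩ := Metric.uniformContinuousOn_iff.mp
    (hS.uniformContinuousOn_of_continuous hv) (ε / 2) (half_pos hε)
  have h1 : Tendsto (fun k => dist (q k) qs + ‖t k‖) atTop (𝓝 0) := by
    have := (tendsto_iff_dist_tendsto_zero.mp hq).add (tendsto_zero_iff_norm_tendsto_zero.mp ht)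
    simpa using this
  filter_upwards [hF (ε / 2) (half_pos hε), h1.eventually_lt_const hη] with k hk1 hk2 ζ hζ
  rw [mem_ball_zero_iff] at hζ
  have hw : q k + t k • ζ ∈ S := hmem k ζ hζ
  have hdist : dist qs (q k + t k • ζ) < η := by
    have h3 : ‖t k‖ * ‖ζ‖ ≤ ‖t k‖ := mul_le_of_le_one_right (norm_nonneg _) hζ.le
    calc dist qs (q k + t k • ζ) ≤ dist qs (q k) + dist (q k) (q k + t k • ζ) :=
          dist_triangle _ _ _
      _ = dist (q k) qs + ‖t k‖ * ‖ζ‖ := by rw [dist_comm qs, dist_self_add_right, norm_smul]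
      _ < η := by linarith
  calc dist (v qs) (F k (q k + t k • ζ))
      ≤ dist (v qs) (v (q k + t k • ζ)) + dist (v (q k + t k • ζ)) (F k (q k + t k • ζ)) :=
        dist_triangle _ _ _
    _ < ε / 2 + ε / 2 := add_lt_add (hvη qs hqs _ hw hdist) (hk1 _ hw)
    _ = ε := add_halves ε

end Limits

end Literature.Geometry.Symplectic.JHolomorphicWeierstrassProof

/-!
## Part `SullivanDualWitnessChargeHelperGradBoundOfC0`:
### Helper `helper_gradBoundOfC0_of` of line `Sketch` for crux `WitnessCharge`
(item stmt-SmoothPoincare4-7824, route `SullivanDual`; discharge of the named fact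
`JHolomorphicWeierstrassR4`, Zalcman upgrade: `C⁰_loc` convergence forces local gradient bounds)

**Statement.** Let `J` be a smooth almost complex structure on `ℝ⁴`, `U ⊆ ℂ` open and
`u n : ℂ → ℝ⁴` maps that are `C^∞` and flat-`J`-holomorphic on `U` and converge locally uniformly
on `U`.  GIVEN (first hypothesis `hD`) derivative bounds of all orders on compact subsets for
flat-`J`-holomorphic sequences with `C⁰` and `C¹` bounds on compact subsets, and (second hypothesis
`hS`) the local smooth-limit lemma, the gradients `‖d(u n)‖` are bounded on every compact
`K ⊆ U`, uniformly in `n`.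

**Proof (Zalcman–Brody rescaling).** By compactness of `K` it suffices to bound the gradients on
a small disc around each point `z⋆ ∈ U`.  Fix `δ > 0` with `B̄(z⋆, 4δ) ⊆ U`; on this compact disc
`u n → v` uniformly, so the `u n` are uniformly bounded there by some `R`.  If the gradients were
unbounded on `B(z⋆, δ)`, pick `n_j`, `z_j ∈ B(z⋆, δ)` with `‖d(u n_j)(z_j)‖ > 2/δ + j`; then
`n_j → ∞` (finitely many maps have bounded gradients near `z⋆`).  The rescaled maps
`f_j(w) = u n_j (z_j + δ w)` are `C¹` on `B(0, 2)` with `‖df_j(0)‖ > 2 + δ j`.  The Zalcman lemma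
with domain control (`helper_gradBoundOfC0_zalcman` of the sibling file
`Summits/SmoothPoincare4/SmoothPoincare4/Theorems/` +
`SullivanDualWitnessChargeHelperGradBoundOfC0Aux.lean`, which also provides the affine chain
rule and the uniform-limit lemmas `GradBound.*`) yields centres `‖ξ_j‖ < 1`, scales
`ρ_j ≤ 1 / M_j → 0` and maps `g_j(ζ) = f_j(ξ_j + ρ_j ζ) = u n_j (p_j + δ ρ_j ζ)`,
`p_j = z_j + δ ξ_j ∈ B̄(z⋆, 4δ)`, with `‖dg_j(0)‖ = 1`, `‖dg_j‖ ≤ 2` and values `u n_j(B̄(z⋆, 4δ))`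
on the closed unit disc.  Along a subsequence `p_j → p⋆`; since `ρ_j → 0`, `u n_j → v` uniformly
near `z⋆` and `v` is uniformly continuous there, `g_j → v(p⋆)` (a constant!) uniformly on the
unit disc.  The `g_j` are `C^∞` and flat-`J`-holomorphic on the open unit disc with `C⁰` bound
`R` and `C¹` bound `2`, so `hD` bounds all their derivatives on compact subsets and `hS` gives
`dg_j(0) → d(const)(0) = 0`, contradicting `‖dg_j(0)‖ = 1`.

References: L. Zalcman, Amer. Math. Monthly 82 (1975); R. Brody, Trans. AMS 235 (1978);
C. Hummel, *Gromov's compactness theorem for pseudo-holomorphic curves* (1997), III.3.1.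
-/

open scoped ContDiff Topology Nat
open Filter Set Metric

namespace Literature.Geometry.Symplectic.JHolomorphicWeierstrassProof

variable {d : ℕ}
/-- **Local gradient bound (the Zalcman–Brody blow-up argument).** Under the two hypotheses of
`helper_gradBoundOfC0_of` (derivative bounds of all orders from `C⁰` + `C¹` bounds, and the local
smooth-limit lemma), flat-`J`-holomorphic maps on an open `U` converging locally uniformly on `U`
have gradients bounded uniformly in `n` on a small disc around every point of `U`. [folklore] -/
theorem helper_gradBoundOfC0_local
    (hD :
      ∀ (J : EuclideanSpace ℝ (Fin d) → EuclideanSpace ℝ (Fin d) →L[ℝ] EuclideanSpace ℝ (Fin d)),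
      ContDiff ℝ ∞ J → (∀ x v, J x (J x v) = -v) →
      ∀ (U : Set ℂ), IsOpen U → ∀ (u : ℕ → ℂ → EuclideanSpace ℝ (Fin d)),
      (∀ n, ContDiffOn ℝ ∞ (u n) U) →
      (∀ n, ∀ z ∈ U, ∀ ζ : ℂ, fderiv ℝ (u n) z (Complex.I * ζ) = J (u n z) (fderiv ℝ (u n) z ζ)) →
      (∀ K : Set ℂ, IsCompact K → K ⊆ U → ∃ R : ℝ, ∀ n, ∀ z ∈ K, ‖u n z‖ ≤ R) →
      (∀ K : Set ℂ, IsCompact K → K ⊆ U → ∃ L : ℝ, ∀ n, ∀ z ∈ K, ‖fderiv ℝ (u n) z‖ ≤ L) →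
      ∀ (k : ℕ) (K : Set ℂ), IsCompact K → K ⊆ U →
        ∃ C : ℝ, ∀ n, ∀ z ∈ K, ‖iteratedFDeriv ℝ k (u n) z‖ ≤ C)
    (hS : ∀ (U : Set ℂ), IsOpen U →
      ∀ (u : ℕ → ℂ → EuclideanSpace ℝ (Fin d)) (v : ℂ → EuclideanSpace ℝ (Fin d)),
      (∀ n, ContDiffOn ℝ ∞ (u n) U) →
      (∀ (k : ℕ) (K : Set ℂ), IsCompact K → K ⊆ U →
        ∃ C : ℝ, ∀ n, ∀ z ∈ K, ‖iteratedFDeriv ℝ k (u n) z‖ ≤ C) →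
      TendstoLocallyUniformlyOn u v atTop U →
      ContDiffOn ℝ ∞ v U ∧
        TendstoLocallyUniformlyOn (fun n => fderiv ℝ (u n)) (fderiv ℝ v) atTop U)
    {J : EuclideanSpace ℝ (Fin d) → EuclideanSpace ℝ (Fin d) →L[ℝ] EuclideanSpace ℝ (Fin d)}
    (hJs : ContDiff ℝ ∞ J) (hJ2 : ∀ x v, J x (J x v) = -v)
    {U : Set ℂ} (hU : IsOpen U) {u : ℕ → ℂ → EuclideanSpace ℝ (Fin d)}
    {v : ℂ → EuclideanSpace ℝ (Fin d)}
    (hu : ∀ n, ContDiffOn ℝ ∞ (u n) U)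
    (huJ : ∀ n, ∀ z ∈ U, ∀ ζ : ℂ,
      fderiv ℝ (u n) z (Complex.I * ζ) = J (u n z) (fderiv ℝ (u n) z ζ))
    (hlim : TendstoLocallyUniformlyOn u v atTop U) {zs : ℂ} (hzs : zs ∈ U) :
    ∃ δ > 0, ∃ L : ℝ, ∀ n, ∀ z ∈ ball zs δ, ‖fderiv ℝ (u n) z‖ ≤ L := by
  /- room: `closedBall zs (4 δ) ⊆ U` -/
  obtain ⟨r, hr, hrU⟩ := Metric.nhds_basis_closedBall.mem_iff.mp (hU.mem_nhds hzs)
  obtain ⟨δ, hδ, hδr⟩ : ∃ δ : ℝ, 0 < δ ∧ 4 * δ = r := ⟨r / 4, by positivity, by ring⟩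
  set S : Set ℂ := closedBall zs (4 * δ) with hSdef
  have hSU : S ⊆ U := by rw [hSdef, hδr]; exact hrU
  have hSc : IsCompact S := isCompact_closedBall _ _
  have hcont : ∀ n, ContinuousOn (u n) S := fun n => (hu n).continuousOn.mono hSU
  have hdiffU : ∀ n, DifferentiableOn ℝ (u n) U := fun n => (hu n).differentiableOn (by simp)
  /- uniform convergence on `S`, continuity of the limit, uniform `C⁰` bound -/
  have hunif : TendstoUniformlyOn u v atTop S :=
    (tendstoLocallyUniformlyOn_iff_forall_isCompact hU).mp hlim S hSU hSc
  have hvS : ContinuousOn v S := hunif.continuousOn (Frequently.of_forall hcont)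
  obtain ⟨R, hR⟩ := GradBound.exists_bound_of_tendstoUniformlyOn hSc hcont hunif
  refine ⟨δ, hδ, ?_⟩
  by_contra hcon
  push Not at hcon
  /- blow-up sequence: `z j ∈ ball zs δ`, `‖d(u (n j))(z j)‖ > 2 / δ + j` -/
  choose n z hz hnz using fun j : ℕ => hcon (2 / δ + j)
  have hA : ∀ j (w : ℂ), ‖w‖ ≤ 3 → z j + δ • w ∈ S := fun j w hw => by
    rw [hSdef, mem_closedBall, dist_eq_norm, add_sub_right_comm]
    have h1 : ‖z j - zs‖ < δ := by rw [← dist_eq_norm]; exact hz j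
    have h2 : δ * ‖w‖ ≤ δ * 3 := mul_le_mul_of_nonneg_left hw hδ.le
    calc ‖z j - zs + δ • w‖ ≤ ‖z j - zs‖ + ‖δ • w‖ := norm_add_le _ _
      _ = ‖z j - zs‖ + δ * ‖w‖ := by rw [norm_smul, Real.norm_of_nonneg hδ.le]
      _ ≤ 4 * δ := by linarith
  have hzS : ∀ j, z j ∈ S := fun j => by simpa using hA j 0 (by norm_num)
  /- the indices `n j` tend to infinity: finitely many maps have bounded gradients on `S` -/
  have hn : Tendsto n atTop atTop := by
    refine tendsto_atTop_atTop.mpr fun N => ?_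
    obtain ⟨B, hB⟩ := GradBound.exists_bound_head (fun m w => ‖fderiv ℝ (u m) w‖)
      (fun m => hSc.exists_bound_of_continuousOn
        (((hu m).continuousOn_fderiv_of_isOpen hU (by simp)).mono hSU)) N
    refine ⟨⌈B⌉₊, fun j hj => ?_⟩
    by_contra hlt
    push Not at hlt
    have h1 : ‖fderiv ℝ (u (n j)) (z j)‖ ≤ B := hB (n j) hlt.le (z j) (hzS j)
    have h2 : B ≤ j := (Nat.le_ceil B).trans (by exact_mod_cast hj)
    have h3 := hnz j
    have h4 : (0 : ℝ) < 2 / δ := by positivity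
    linarith
  /- the rescaled maps `f j w = u (n j) (z j + δ • w)`, `C¹` on `ball 0 2`, `‖df_j(0)‖ > 2 + δ j` -/
  set f : ℕ → ℂ → EuclideanSpace ℝ (Fin d) := fun j w => u (n j) (z j + δ • w) with hf
  have hfV : ∀ j, MapsTo (fun w : ℂ => z j + δ • w) (ball 0 2) U := fun j w hw =>
    hSU (hA j w (by linarith [mem_ball_zero_iff.mp hw]))
  have hf1 : ∀ j, ContDiffOn ℝ 1 (f j) (ball 0 2) := fun j =>
    (GradBound.contDiffOn_comp_affine (hu (n j)) (z j) δ (hfV j)).of_le (by exact_mod_cast le_top)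
  have hnf0 : ∀ j, ‖fderiv ℝ (f j) 0‖ = δ * ‖fderiv ℝ (u (n j)) (z j)‖ := fun j => by
    have hd : DifferentiableAt ℝ (u (n j)) (z j + δ • (0 : ℂ)) := by
      rw [smul_zero, add_zero]
      exact (hdiffU (n j)).differentiableAt (hU.mem_nhds (hSU (hzS j)))
    have := GradBound.norm_fderiv_comp_affine hd hδ.le
    rw [smul_zero, add_zero] at this
    simpa only [hf] using this
  have hbig : ∀ j, 2 + δ * j < ‖fderiv ℝ (f j) 0‖ := fun j => by
    rw [hnf0 j]
    have h1 := mul_lt_mul_of_pos_left (hnz j) hδ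
    have h2 : δ * (2 / δ + j) = 2 + δ * j := by
      field_simp
    linarith
  have hne : ∀ j, fderiv ℝ (f j) 0 ≠ 0 := fun j h => by
    have h1 := hbig j
    rw [h, norm_zero] at h1
    have h2 : (0 : ℝ) ≤ δ * j := by positivity
    linarith
  /- Zalcman rescaling with domain control, for every `j` -/
  choose ξ ρ M hρ hξ hM hρM hdom h1 h2 using
    fun j => helper_gradBoundOfC0_zalcman (f j) (hf1 j) (hne j)
  have hM2 : ∀ j, 2 + δ * j < M j := fun j => (hbig j).trans_le (hM j)
  have hM1 : ∀ j (ζ : ℂ), ‖ζ‖ ≤ 1 → ‖ζ‖ ≤ M j / 2 := fun j ζ hζ => by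
    have := hM2 j
    have : (0 : ℝ) ≤ δ * j := by positivity
    linarith
  have hin : ∀ j (ζ : ℂ), ‖ζ‖ ≤ 1 → ‖ξ j + ρ j • ζ‖ < 1 := fun j ζ hζ => by
    have := hdom j ζ (hM1 j ζ hζ)
    have := hξ j
    linarith
  have hρle : ∀ j, ρ j ≤ 1 / (2 + δ * j) := fun j => by
    rw [le_div_iff₀ (by positivity)]
    exact (mul_le_mul_of_nonneg_left (hM2 j).le (hρ j).le).trans (hρM j)
  /- the centres `p j = z j + δ • ξ j` and the rescaled maps `ζ ↦ u (n j) (p j + (δ ρ j) • ζ)` -/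
  set p : ℕ → ℂ := fun j => z j + δ • ξ j with hp
  have hfg : ∀ j, (fun ζ : ℂ => f j (ξ j + ρ j • ζ)) =
      fun ζ : ℂ => u (n j) (p j + (δ * ρ j) • ζ) := fun j => by
    funext ζ
    simp only [hf, hp, smul_add, smul_smul, add_assoc]
  have hmemS : ∀ j (ζ : ℂ), ‖ζ‖ ≤ 1 → p j + (δ * ρ j) • ζ ∈ S := fun j ζ hζ => by
    have e : p j + (δ * ρ j) • ζ = z j + δ • (ξ j + ρ j • ζ) := by
      simp only [hp, smul_add, smul_smul, add_assoc]
    rw [e]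
    exact hA j _ (by linarith [hin j ζ hζ])
  have hpS : ∀ j, p j ∈ S := fun j => by simpa using hmemS j 0 (by norm_num)
  /- subsequence with convergent centres; along it `ρ → 0` and `n → ∞` -/
  obtain ⟨ps, hps, σ, hσ, hpσ⟩ := hSc.tendsto_subseq hpS
  have hMt : Tendsto (fun k : ℕ => 2 + δ * (σ k : ℝ)) atTop atTop :=
    tendsto_atTop_add_const_left _ _
      ((tendsto_natCast_atTop_atTop.comp hσ.tendsto_atTop).const_mul_atTop hδ)
  have hρσ : Tendsto (fun k => ρ (σ k)) atTop (𝓝 0) :=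
    squeeze_zero (fun k => (hρ _).le) (fun k => hρle (σ k)) (tendsto_const_nhds.div_atTop hMt)
  have hρ0 : Tendsto (fun k => δ * ρ (σ k)) atTop (𝓝 0) := by
    simpa using hρσ.const_mul δ
  have hunifσ : TendstoUniformlyOn (fun k => u (n (σ k))) v atTop S :=
    hunif.seq_tendstoUniformlyOn _ (hn.comp hσ.tendsto_atTop)
  set G : ℕ → ℂ → EuclideanSpace ℝ (Fin d) :=
    fun k ζ => u (n (σ k)) (p (σ k) + (δ * ρ (σ k)) • ζ) with hG
  have hmapV : ∀ k, MapsTo (fun η : ℂ => p (σ k) + (δ * ρ (σ k)) • η) (ball 0 1) U :=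
    fun k η hη => hSU (hmemS (σ k) η (mem_ball_zero_iff.mp hη).le)
  have hGsmooth : ∀ k, ContDiffOn ℝ ∞ (G k) (ball 0 1) := fun k =>
    GradBound.contDiffOn_comp_affine (hu (n (σ k))) (p (σ k)) (δ * ρ (σ k)) (hmapV k)
  have hGJ : ∀ k, ∀ η ∈ ball (0 : ℂ) 1, ∀ ζ : ℂ,
      fderiv ℝ (G k) η (Complex.I * ζ) = J (G k η) (fderiv ℝ (G k) η ζ) := fun k =>
    GradBound.jHol_comp_affine hU (hdiffU _) (huJ _) (p (σ k)) (δ * ρ (σ k)) (hmapV k)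
  have hG1 : ∀ k, ‖fderiv ℝ (G k) 0‖ = 1 := fun k => by
    have := h1 (σ k)
    rwa [hfg] at this
  have hG2 : ∀ k (ζ : ℂ), ‖ζ‖ ≤ 1 → ‖fderiv ℝ (G k) ζ‖ ≤ 2 := fun k ζ hζ => by
    have := h2 (σ k) ζ (hM1 _ ζ hζ)
    rwa [hfg] at this
  have hGR : ∀ k (ζ : ℂ), ‖ζ‖ ≤ 1 → ‖G k ζ‖ ≤ R := fun k ζ hζ =>
    hR (n (σ k)) _ (hmemS (σ k) ζ hζ)
  have hGlim : TendstoUniformlyOn G (fun _ => v ps) atTop (ball 0 1) :=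
    GradBound.tendstoUniformlyOn_const hSc hvS hunifσ (q := fun k => p (σ k)) hpσ hps
      (t := fun k => δ * ρ (σ k)) hρ0 (fun k ζ hζ => hmemS (σ k) ζ hζ.le)
  /- derivative bounds of all orders (`hD`) and the smooth-limit lemma (`hS`) on the unit disc -/
  have hDG := hD J hJs hJ2 (ball (0 : ℂ) 1) isOpen_ball G hGsmooth hGJ
    (fun K' _ hK'V => ⟨R, fun k ζ hζ => hGR k ζ (mem_ball_zero_iff.mp (hK'V hζ)).le⟩)
    (fun K' _ hK'V => ⟨2, fun k ζ hζ => hG2 k ζ (mem_ball_zero_iff.mp (hK'V hζ)).le⟩)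
  obtain ⟨-, hSd⟩ := hS (ball (0 : ℂ) 1) isOpen_ball G (fun _ => v ps) hGsmooth hDG
    hGlim.tendstoLocallyUniformlyOn
  have ht : Tendsto (fun k => ‖fderiv ℝ (G k) 0‖) atTop
      (𝓝 ‖fderiv ℝ (fun _ : ℂ => v ps) (0 : ℂ)‖) :=
    (hSd.tendsto_at (mem_ball_self one_pos)).norm
  rw [fderiv_const_apply, norm_zero] at ht
  simp only [hG1] at ht
  exact one_ne_zero (tendsto_nhds_unique tendsto_const_nhds ht)

/-- **Stub A5 (Zalcman upgrade: `C⁰_loc` convergence forces local gradient bounds).**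
Flat `J`-holomorphic maps on an open `U` converging locally uniformly on `U` have gradients
bounded uniformly in `n` on compact subsets of `U`: otherwise Zalcman rescaling
(`helper_gradBoundOfC0_zalcman`) at a blow-up point produces maps with gradient `1` at the origin
and `≤ 2` on the unit disc, which by the derivative bounds (first hypothesis) and the local smooth
limit lemma (second hypothesis) converge in `C¹_loc` — to a CONSTANT (the original maps converge
uniformly near the blow-up point and the rescaling radii shrink to `0`), contradiction
(`helper_gradBoundOfC0_local`); the compact `K` is then exhausted by `IsCompact.induction_on`. [folklore] -/
theorem helper_gradBoundOfC0_of :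
    (∀ (J : EuclideanSpace ℝ (Fin d) → EuclideanSpace ℝ (Fin d) →L[ℝ] EuclideanSpace ℝ (Fin d)),
      ContDiff ℝ ∞ J → (∀ x v, J x (J x v) = -v) →
    ∀ (U : Set ℂ), IsOpen U → ∀ (u : ℕ → ℂ → EuclideanSpace ℝ (Fin d)),
      (∀ n, ContDiffOn ℝ ∞ (u n) U) →
      (∀ n, ∀ z ∈ U, ∀ ζ : ℂ, fderiv ℝ (u n) z (Complex.I * ζ) = J (u n z) (fderiv ℝ (u n) z ζ)) →
      (∀ K : Set ℂ, IsCompact K → K ⊆ U → ∃ R : ℝ, ∀ n, ∀ z ∈ K, ‖u n z‖ ≤ R) →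
      (∀ K : Set ℂ, IsCompact K → K ⊆ U → ∃ L : ℝ, ∀ n, ∀ z ∈ K, ‖fderiv ℝ (u n) z‖ ≤ L) →
      ∀ (k : ℕ) (K : Set ℂ), IsCompact K → K ⊆ U →
        ∃ C : ℝ, ∀ n, ∀ z ∈ K, ‖iteratedFDeriv ℝ k (u n) z‖ ≤ C) →
    (∀ (U : Set ℂ), IsOpen U →
      ∀ (u : ℕ → ℂ → EuclideanSpace ℝ (Fin d)) (v : ℂ → EuclideanSpace ℝ (Fin d)),
      (∀ n, ContDiffOn ℝ ∞ (u n) U) →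
      (∀ (k : ℕ) (K : Set ℂ), IsCompact K → K ⊆ U →
        ∃ C : ℝ, ∀ n, ∀ z ∈ K, ‖iteratedFDeriv ℝ k (u n) z‖ ≤ C) →
      TendstoLocallyUniformlyOn u v atTop U →
      ContDiffOn ℝ ∞ v U ∧
        TendstoLocallyUniformlyOn (fun n => fderiv ℝ (u n)) (fderiv ℝ v) atTop U) →
    ∀ (J : EuclideanSpace ℝ (Fin d) → EuclideanSpace ℝ (Fin d) →L[ℝ] EuclideanSpace ℝ (Fin d)),
      ContDiff ℝ ∞ J → (∀ x v, J x (J x v) = -v) →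
    ∀ (U : Set ℂ), IsOpen U →
      ∀ (u : ℕ → ℂ → EuclideanSpace ℝ (Fin d)) (v : ℂ → EuclideanSpace ℝ (Fin d)),
      (∀ n, ContDiffOn ℝ ∞ (u n) U) →
      (∀ n, ∀ z ∈ U, ∀ ζ : ℂ, fderiv ℝ (u n) z (Complex.I * ζ) = J (u n z) (fderiv ℝ (u n) z ζ)) →
      TendstoLocallyUniformlyOn u v atTop U →
      ∀ K : Set ℂ, IsCompact K → K ⊆ U → ∃ L : ℝ, ∀ n, ∀ z ∈ K, ‖fderiv ℝ (u n) z‖ ≤ L := by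
  intro hD hS J hJs hJ2 U hU u v hu huJ hlim K hK hKU
  refine hK.induction_on ⟨0, fun n z hz => ?_⟩ (fun s t hst ⟨L, hL⟩ => ?_)
    (fun s t ⟨L₁, h₁⟩ ⟨L₂, h₂⟩ => ?_) (fun x hx => ?_)
  · exact absurd hz (notMem_empty z)
  · exact ⟨L, fun n z hz => hL n z (hst hz)⟩
  · exact ⟨max L₁ L₂, fun n z hz => hz.elim (fun h => (h₁ n z h).trans (le_max_left _ _))
      fun h => (h₂ n z h).trans (le_max_right _ _)⟩
  · obtain ⟨δ, hδ, L, hL⟩ := helper_gradBoundOfC0_local hD hS hJs hJ2 hU hu huJ hlim (hKU hx)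
    exact ⟨ball x δ, mem_nhdsWithin_of_mem_nhds (ball_mem_nhds x hδ), L, hL⟩

end Literature.Geometry.Symplectic.JHolomorphicWeierstrassProof

/-!
## Part `SullivanDualWitnessChargeHelperAlphaLocal`:
### Local step α of the elliptic bootstrapping for flat `J`-holomorphic discs in `ℝ⁴`

Helper file of the lead (c2) for line `Sketch` of the crux `WitnessCharge`
(stmt-SmoothPoincare4-7824, route SullivanDual), registered stub `helper_alphaLocal`.

It localises the landed theorem `Apriori.alpha` of the sibling crux `TameOrBrodyR4`
(`SullivanDualTameOrBrodyR4AprioriAlpha`): the global flat `J`-holomorphicity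
`IsJHolomorphicFlat J g` is replaced by the equation `dg(z)(iζ) = J(g z) (dg(z) ζ)` on the open
disc `‖z‖ < 2` only, and the two abstract inequalities `h1`, `hB` of `alpha` are discharged by the
landed stubs `stub_h1Estimate` (constant-coefficient `H¹` identity) and `stub_normIteratedFDerivLe`
(basis control of multilinear maps on `ℂⁿ`). The equation enters `alpha` only through the
commutator identity at points of the closed unit disc; here the global identity of functions
`∂₂ g = (J ∘ g) ∂₁ g` is replaced by an eventual equality near each point of the disc of radius `2`,
which suffices for the iterated derivatives (`Filter.EventuallyEq.iteratedFDeriv`). Conclusion, as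
in `alpha`: with the orders `1 ≤ i ≤ n - 2` frozen on the disc of radius `ρ`,
`∫_{D_{ρ'}} ‖D^{n+1}g‖² ≤ C (1 + ∫_{D_ρ} ‖D^{n-1}g‖⁴ + ∫_{D_ρ} ‖Dⁿg‖²)` with `C` independent of `g`.
-/

open scoped ContDiff Topology Nat
open Filter Set Metric MeasureTheory Literature.Geometry.Symplectic
open Literature.Geometry.Symplectic.JHolomorphicWeierstrassProof
open Literature.Geometry.Symplectic.JHolomorphicWeierstrassProof.Apriori

namespace Literature.Geometry.Symplectic.JHolomorphicWeierstrassProof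

variable {d : ℕ}
/-- **The commutator identity, local version.** If the flat `J`-holomorphicity equation
`dg(y)(iζ) = J(g y) (dg(y) ζ)` holds on the open disc `‖y‖ < 2`, then at every point `z` of that
disc, with `A = J ∘ g` and `p = ∂₁ g`, the word derivative `w = Dⁿg · m` satisfies
`∂₂ w (z) - A(z) (∂₁ w (z)) = (Dⁿ(A p)(z) - A(z) ∘ Dⁿp(z))(m)` (the functions `∂₂ g` and
`(J ∘ g) ∂₁ g` agree near `z`, hence so do their iterated derivatives at `z`). [folklore] -/
theorem commutator_identity_local
    {J : EuclideanSpace ℝ (Fin d) → EuclideanSpace ℝ (Fin d) →L[ℝ] EuclideanSpace ℝ (Fin d)}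
    {g : ℂ → EuclideanSpace ℝ (Fin d)} (hg : ContDiff ℝ ∞ g)
    (hgJ : ∀ z : ℂ, ‖z‖ < 2 → ∀ ζ : ℂ, fderiv ℝ g z (Complex.I * ζ) = J (g z) (fderiv ℝ g z ζ))
    (n : ℕ) (m : Fin n → ℂ) {z : ℂ} (hz : ‖z‖ < 2) :
    fderiv ℝ (iteratedFDeriv ℝ n g · m) z Complex.I -
        J (g z) (fderiv ℝ (iteratedFDeriv ℝ n g · m) z 1) =
      (iteratedFDeriv ℝ n (fun y => J (g y) (fderiv ℝ g y 1)) z -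
        (J (g z)).compContinuousMultilinearMap (iteratedFDeriv ℝ n (fderiv ℝ g · 1) z)) m := by
  have hI := congrFun (fderiv_iteratedFDeriv_apply_comm hg Complex.I n m) z
  have h1 := congrFun (fderiv_iteratedFDeriv_apply_comm hg 1 n m) z
  -- the equation in word form `∂₂ g = (J ∘ g) ∂₁ g`, near `z`
  have hloc : (fderiv ℝ g · Complex.I) =ᶠ[𝓝 z] fun y => J (g y) (fderiv ℝ g y 1) := by
    refine Filter.eventuallyEq_of_mem (isOpen_ball.mem_nhds (mem_ball_zero_iff.mpr hz)) ?_
    intro y hy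
    have h := hgJ y (mem_ball_zero_iff.mp hy) 1
    rw [mul_one] at h
    exact h
  have hit : iteratedFDeriv ℝ n (fderiv ℝ g · Complex.I) z =
      iteratedFDeriv ℝ n (fun y => J (g y) (fderiv ℝ g y 1)) z :=
    (hloc.iteratedFDeriv ℝ n).eq_of_nhds
  rw [hI, h1, hit, sub_apply, ContinuousLinearMap.compContinuousMultilinearMap_coe,
    Function.comp_apply]

/-- **The pointwise source bound, local version.** For the source `∂₂w_L - (J∘g) ∂₁w_L` of a word
derivative `w_L = Dⁿg · e_L` at a point `z` of the open disc of radius `2` on which the flat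
`J`-holomorphicity equation holds: local commutator identity + the landed bound `source_le`. [folklore] -/
theorem source_pointwise_local
    {J : EuclideanSpace ℝ (Fin d) → EuclideanSpace ℝ (Fin d) →L[ℝ] EuclideanSpace ℝ (Fin d)}
    {g : ℂ → EuclideanSpace ℝ (Fin d)} (hJs : ContDiff ℝ ∞ J) (hg : ContDiff ℝ ∞ g)
    (hgJ : ∀ z : ℂ, ‖z‖ < 2 → ∀ ζ : ℂ, fderiv ℝ g z (Complex.I * ζ) = J (g z) (fderiv ℝ g z ζ))
    {n : ℕ} (hn : 1 ≤ n) {M S : ℝ} (hS : 2 ≤ S) (L : Fin n → Fin 2) {z : ℂ} (hz : ‖z‖ < 2)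
    (hM : ∀ i, i ≤ n → ‖iteratedFDeriv ℝ i J (g z)‖ ≤ M) (h1 : ‖fderiv ℝ g z‖ ≤ 2)
    (hlow : ∀ i, 1 ≤ i → i + 2 ≤ n → ‖iteratedFDeriv ℝ i g z‖ ≤ S) :
    ‖fderiv ℝ (iteratedFDeriv ℝ n g · (fun j => ![(1 : ℂ), Complex.I] (L j))) z Complex.I -
        J (g z) (fderiv ℝ (iteratedFDeriv ℝ n g · (fun j => ![(1 : ℂ), Complex.I] (L j))) z 1)‖ ≤
      (∑ j ∈ Finset.range n,
        (n.choose (j + 1) : ℝ) * (j + 1)! * M * (S ^ (j + 1) + 1 + S ^ 2 + S) * (2 * S)) *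
      (1 + ‖iteratedFDeriv ℝ (n - 1) g z‖ ^ 2 + ‖iteratedFDeriv ℝ n g z‖) := by
  rw [commutator_identity_local hg hgJ n _ hz]
  refine (ContinuousMultilinearMap.le_opNorm _ _).trans ?_
  have hprod : ∏ j : Fin n, ‖(![(1 : ℂ), Complex.I] : Fin 2 → ℂ) (L j)‖ = 1 :=
    Finset.prod_eq_one fun j _ => norm_basis_eq_one (L j)
  rw [hprod, mul_one]
  have h1' : ‖iteratedFDeriv ℝ 1 g z‖ ≤ 2 := by rw [norm_iteratedFDeriv_one]; exact h1
  exact source_le hJs hg hn hS z hM h1' hlow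

/-- **Stub A1 (local step α).** `Apriori.alpha` of the `TameOrBrodyR4` chain with the global
flat `J`-holomorphicity replaced by the equation on the open disc of radius `2` (the inequalities
`h1`, `hB` of `alpha` are the landed `stub_h1Estimate`, `stub_normIteratedFDerivLe`): with the
orders `1 ≤ i ≤ n - 2` frozen on the disc of radius `ρ` (`ρ` so small that `J ∘ g` is `ε`-close to
`J(g 0)` with `4(1 + M₀²)ε² ≤ 1`),
`∫_{D_{ρ'}} ‖D^{n+1}g‖² ≤ C (1 + ∫_{D_ρ} ‖D^{n-1}g‖⁴ + ∫_{D_ρ} ‖Dⁿg‖²)` with `C` independent of `g`. [folklore] -/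
theorem helper_alphaLocal :
    ∀ (J : EuclideanSpace ℝ (Fin d) → EuclideanSpace ℝ (Fin d) →L[ℝ] EuclideanSpace ℝ (Fin d)),
      ContDiff ℝ ∞ J → (∀ x v, J x (J x v) = -v) →
    ∀ (R₀ M₀ M₁ : ℝ), (∀ x : EuclideanSpace ℝ (Fin d), ‖x‖ ≤ R₀ → ‖J x‖ ≤ M₀) →
      (∀ x : EuclideanSpace ℝ (Fin d), ‖x‖ ≤ R₀ → ‖fderiv ℝ J x‖ ≤ M₁) →
    ∀ (n : ℕ), 1 ≤ n → ∀ (ρ' ρ : ℝ), 0 < ρ' → ρ' < ρ → ρ ≤ 1 →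
      16 * (1 + M₀ ^ 2) * M₁ ^ 2 * ρ ^ 2 ≤ 1 → ∀ (S : ℝ),
    ∃ C : ℝ, ∀ g : ℂ → EuclideanSpace ℝ (Fin d), ContDiff ℝ ∞ g →
      (∀ z : ℂ, ‖z‖ < 2 → ∀ ζ : ℂ, fderiv ℝ g z (Complex.I * ζ) = J (g z) (fderiv ℝ g z ζ)) →
      (∀ z : ℂ, ‖z‖ ≤ 1 → ‖g z‖ ≤ R₀) → (∀ z : ℂ, ‖z‖ ≤ 1 → ‖fderiv ℝ g z‖ ≤ 2) →
      (∀ i, 1 ≤ i → i + 2 ≤ n → ∀ z : ℂ, ‖z‖ ≤ ρ → ‖iteratedFDeriv ℝ i g z‖ ≤ S) →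
      ∫ z in Metric.closedBall (0 : ℂ) ρ', ‖iteratedFDeriv ℝ (n + 1) g z‖ ^ 2 ≤
        C * (1 + (∫ z in Metric.closedBall (0 : ℂ) ρ, ‖iteratedFDeriv ℝ (n - 1) g z‖ ^ 4) +
          ∫ z in Metric.closedBall (0 : ℂ) ρ, ‖iteratedFDeriv ℝ n g z‖ ^ 2) := by
  intro J hJs hJ2 R₀ M₀ M₁ hM₀ hM₁ n hn ρ' ρ hρ' hρ'ρ hρ1 hρδ S
  -- degenerate case `R₀ < 0`: the hypotheses on `g` are contradictory
  rcases lt_or_ge R₀ 0 with hR | hR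
  · refine ⟨0, fun g _ _ hg0 _ _ => ?_⟩
    exact absurd ((norm_nonneg (g 0)).trans (hg0 0 (by simp))) (not_le.mpr hR)
  -- constants independent of `g`
  obtain ⟨M, hM⟩ := exists_bound_iteratedFDeriv hJs R₀ n
  have hM0 : 0 ≤ M := (norm_nonneg _).trans (hM 0 (Nat.zero_le _) 0 (by simpa using hR))
  have hS' : (2 : ℝ) ≤ max S 2 := le_max_right _ _
  have hS'0 : (0 : ℝ) ≤ max S 2 := zero_le_two.trans hS'
  obtain ⟨Cs, hCs_def⟩ : ∃ Cs : ℝ, Cs = ∑ j ∈ Finset.range n, (n.choose (j + 1) : ℝ) * (j + 1)! * M *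
      ((max S 2) ^ (j + 1) + 1 + (max S 2) ^ 2 + max S 2) * (2 * max S 2) := ⟨_, rfl⟩
  have hCs : 0 ≤ Cs := by rw [hCs_def]; exact srcConst_nonneg n hM0 hS'0
  let χ : ContDiffBump (0 : ℂ) := ⟨(2 * ρ' + ρ) / 3, (ρ' + 2 * ρ) / 3, by linarith, by linarith⟩
  have hχIn : ρ' < χ.rIn := by show ρ' < (2 * ρ' + ρ) / 3; linarith
  have hχOut : χ.rOut < ρ := by show (ρ' + 2 * ρ) / 3 < ρ; linarith
  have hχc : ContDiff ℝ ∞ (χ : ℂ → ℝ) := χ.contDiff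
  have hχs : HasCompactSupport (χ : ℂ → ℝ) := χ.hasCompactSupport
  obtain ⟨Cχ, hCχ⟩ : ∃ C, ∀ z, ‖fderiv ℝ (χ : ℂ → ℝ) z‖ ≤ C :=
    (hχs.fderiv (𝕜 := ℝ)).exists_bound_of_continuous (hχc.continuous_fderiv (by simp))
  have hCχ0 : 0 ≤ Cχ := (norm_nonneg _).trans (hCχ 0)
  have hCχv : ∀ z v, ‖fderiv ℝ (χ : ℂ → ℝ) z v‖ ≤ Cχ * ‖v‖ := fun z v =>
    (ContinuousLinearMap.le_opNorm _ _).trans (mul_le_mul_of_nonneg_right (hCχ z) (norm_nonneg _))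
  have hχ1 : ∀ z, |(χ : ℂ → ℝ) z| ≤ 1 := fun z => by
    rw [abs_of_nonneg χ.nonneg]; exact χ.le_one
  have hsuppχ : ∀ z ∈ tsupport (χ : ℂ → ℝ), ‖z‖ ≤ ρ := by
    intro z hz
    rw [χ.tsupport_eq] at hz
    exact (mem_closedBall_zero_iff.mp hz).trans hχOut.le
  obtain ⟨V, hV⟩ : ∃ V : ℝ, V = (volume (closedBall (0 : ℂ) ρ)).toReal := ⟨_, rfl⟩
  have hV0 : 0 ≤ V := by rw [hV]; exact ENNReal.toReal_nonneg
  have hM₀0 : 0 ≤ M₀ := (norm_nonneg _).trans (hM₀ 0 (by simpa using hR))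
  obtain ⟨K, hK⟩ : ∃ K : ℝ, K = 4 * (1 + M₀ ^ 2) * (6 * Cs ^ 2 * (V + 1) +
      2 * Cχ ^ 2 * (1 + M₀) ^ 2) := ⟨_, rfl⟩
  have hK0 : 0 ≤ K := by rw [hK]; positivity
  refine ⟨(2 : ℝ) ^ (n + 1) * 2 ^ (n + 1) * K, fun g hg hgJ hg0 hg1 hlow => ?_⟩
  -- abbreviations for the fixed map `g`
  have hac : ∀ k, Continuous fun z => ‖iteratedFDeriv ℝ k g z‖ := fun k =>
    (hg.continuous_iteratedFDeriv (m := k) (by exact_mod_cast le_top)).norm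
  have hA : Continuous fun z => J (g z) := hJs.continuous.comp hg.continuous
  have hA₀2 : ∀ v, J (g 0) (J (g 0) v) = -v := hJ2 (g 0)
  have hA₀n : ‖J (g 0)‖ ≤ M₀ := hM₀ _ (hg0 0 (by simp))
  have hAz : ∀ z : ℂ, ‖z‖ ≤ ρ → ‖J (g z)‖ ≤ M₀ := fun z hz => hM₀ _ (hg0 z (hz.trans hρ1))
  -- freezing: `‖J(g z) - J(g 0)‖ ≤ ε := 2 M₁ ρ` on the support of `χ`
  have hM₁0 : 0 ≤ M₁ := (norm_nonneg (fderiv ℝ J (g 0))).trans (hM₁ _ (hg0 0 (by simp)))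
  have hρ0 : 0 ≤ ρ := by linarith
  have hε : 4 * (1 + ‖J (g 0)‖ ^ 2) * (2 * M₁ * ρ) ^ 2 ≤ 1 := by
    have h' : ‖J (g 0)‖ ^ 2 ≤ M₀ ^ 2 := pow_le_pow_left₀ (norm_nonneg _) hA₀n 2
    have : 4 * (1 + ‖J (g 0)‖ ^ 2) * (2 * M₁ * ρ) ^ 2 ≤ 4 * (1 + M₀ ^ 2) * (2 * M₁ * ρ) ^ 2 := by
      apply mul_le_mul_of_nonneg_right _ (sq_nonneg _); linarith
    nlinarith
  have hAε : ∀ z ∈ tsupport (χ : ℂ → ℝ), ‖J (g z) - J (g 0)‖ ≤ 2 * M₁ * ρ := by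
    intro z hz
    have hzρ := hsuppχ z hz
    have hz1 : ‖z‖ ≤ 1 := hzρ.trans hρ1
    have hgz : ‖g z - g 0‖ ≤ 2 * ‖z - 0‖ :=
      (convex_closedBall (0 : ℂ) 1).norm_image_sub_le_of_norm_fderiv_le
        (fun x _ => (hg.differentiable (by simp)) x)
        (fun x hx => hg1 x (mem_closedBall_zero_iff.mp hx))
        (by simp) (mem_closedBall_zero_iff.mpr hz1)
    have hJz : ‖J (g z) - J (g 0)‖ ≤ M₁ * ‖g z - g 0‖ :=
      (convex_closedBall (0 : EuclideanSpace ℝ (Fin d)) R₀).norm_image_sub_le_of_norm_fderiv_le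
        (fun x _ => (hJs.differentiable (by simp)) x)
        (fun x hx => hM₁ x (mem_closedBall_zero_iff.mp hx))
        (mem_closedBall_zero_iff.mpr (hg0 0 (by simp))) (mem_closedBall_zero_iff.mpr (hg0 z hz1))
    rw [sub_zero] at hgz
    calc ‖J (g z) - J (g 0)‖ ≤ M₁ * (2 * ‖z‖) := hJz.trans (mul_le_mul_of_nonneg_left hgz hM₁0)
      _ ≤ M₁ * (2 * ρ) := by gcongr
      _ = 2 * M₁ * ρ := by ring
  -- integrals on the big disc
  obtain ⟨I4, hI4⟩ : ∃ I4 : ℝ, I4 = ∫ z in closedBall (0 : ℂ) ρ, ‖iteratedFDeriv ℝ (n - 1) g z‖ ^ 4 :=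
    ⟨_, rfl⟩
  obtain ⟨I2, hI2⟩ : ∃ I2 : ℝ, I2 = ∫ z in closedBall (0 : ℂ) ρ, ‖iteratedFDeriv ℝ n g z‖ ^ 2 :=
    ⟨_, rfl⟩
  have hI40 : 0 ≤ I4 := by rw [hI4]; exact integral_nonneg fun z => by positivity
  have hI20 : 0 ≤ I2 := by rw [hI2]; exact integral_nonneg fun z => by positivity
  rw [← hI4, ← hI2]
  -- the localized energy bound for every word of length `n`
  have key : ∀ L : Fin n → Fin 2,
      (∫ z, (‖fderiv ℝ (fun t => χ t • iteratedFDeriv ℝ n g t (fun j => ![(1 : ℂ), Complex.I] (L j))) z 1‖ ^ 2 +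
        ‖fderiv ℝ (fun t => χ t • iteratedFDeriv ℝ n g t (fun j => ![(1 : ℂ), Complex.I] (L j))) z
          Complex.I‖ ^ 2)) ≤ K * (1 + I4 + I2) := by
    intro L
    have hw : ContDiff ℝ ∞ (iteratedFDeriv ℝ n g · (fun j => ![(1 : ℂ), Complex.I] (L j))) :=
      contDiff_iteratedFDeriv_apply hg n _
    have hs : ∀ z : ℂ, ‖z‖ ≤ ρ →
        ‖fderiv ℝ (iteratedFDeriv ℝ n g · (fun j => ![(1 : ℂ), Complex.I] (L j))) z Complex.I -
          J (g z) (fderiv ℝ (iteratedFDeriv ℝ n g · (fun j => ![(1 : ℂ), Complex.I] (L j))) z 1)‖ ≤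
        Cs * (1 + ‖iteratedFDeriv ℝ (n - 1) g z‖ ^ 2 + ‖iteratedFDeriv ℝ n g z‖) := by
      intro z hz
      have hz1 : ‖z‖ ≤ 1 := hz.trans hρ1
      have hz2 : ‖z‖ < 2 := hz1.trans_lt one_lt_two
      rw [hCs_def]
      exact source_pointwise_local hJs hg hgJ hn hS' L hz2 (fun i hi => hM i hi _ (hg0 z hz1))
        (hg1 z hz1) (fun i hi1 hi2 => (hlow i hi1 hi2 z hz).trans (le_max_left _ _))
    have hword := alpha_word stub_h1Estimate (J (g 0)) hA₀2 (fun z => J (g z)) hA _ hw χ hχc hχs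
      (2 * M₁ * ρ) hε hAε hCs hM₀0 hsuppχ hχ1 hCχv hAz (fun z => ‖iteratedFDeriv ℝ (n - 1) g z‖)
      (fun z => ‖iteratedFDeriv ℝ n g z‖) (hac _) (hac _) (fun z => norm_nonneg _)
      (fun z => norm_iteratedFDeriv_apply_basis_le g n L z) hs
    rw [← hV, ← hI4, ← hI2] at hword
    rw [hK]
    exact hword.trans (alpha_const_compare (norm_nonneg _) hA₀n hV0 hI40 hI20)
  -- the left-hand side: `a_{n+1}² ≤ 2^{n+1} ∑_{L'} (‖∂₁(χ w_{tail L'})‖² + ‖∂₂(χ w_{tail L'})‖²)` on the small disc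
  have hLHS : ∀ z ∈ closedBall (0 : ℂ) ρ', ‖iteratedFDeriv ℝ (n + 1) g z‖ ^ 2 ≤ (2 : ℝ) ^ (n + 1) *
      ∑ L' : Fin (n + 1) → Fin 2,
        (‖fderiv ℝ (fun t => χ t • iteratedFDeriv ℝ n g t (fun j => ![(1 : ℂ), Complex.I] (Fin.tail L' j))) z 1‖ ^ 2 +
         ‖fderiv ℝ (fun t => χ t • iteratedFDeriv ℝ n g t (fun j => ![(1 : ℂ), Complex.I] (Fin.tail L' j))) z
           Complex.I‖ ^ 2) := by
    intro z hz
    have hzIn : z ∈ ball (0 : ℂ) χ.rIn :=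
      mem_ball_zero_iff.mpr ((mem_closedBall_zero_iff.mp hz).trans_lt hχIn)
    refine (sq_norm_le_of_basis stub_normIteratedFDerivLe (n + 1) (iteratedFDeriv ℝ (n + 1) g z)).trans ?_
    refine mul_le_mul_of_nonneg_left (Finset.sum_le_sum fun L' _ => ?_) (pow_nonneg zero_le_two _)
    have hsucc := iteratedFDeriv_succ_apply_eq_fderiv hg n (fun j => ![(1 : ℂ), Complex.I] (L' j)) z
    have htail : (Fin.tail fun j => (![(1 : ℂ), Complex.I] : Fin 2 → ℂ) (L' j)) =
        fun j => ![(1 : ℂ), Complex.I] (Fin.tail L' j) := rfl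
    rw [htail] at hsucc
    rw [hsucc, ← fderiv_smul_eq_of_mem
      (w := (iteratedFDeriv ℝ n g · (fun j => ![(1 : ℂ), Complex.I] (Fin.tail L' j)))) hzIn]
    rcases Fin.eq_zero_or_eq_succ (L' 0) with h0 | ⟨j, hj⟩
    · simp only [h0, Matrix.cons_val_zero]
      exact le_add_of_nonneg_right (sq_nonneg _)
    · simp only [hj, Fin.eq_zero j, Matrix.cons_val_succ, Matrix.cons_val_zero]
      exact le_add_of_nonneg_left (sq_nonneg _)
  -- integrability of the localized energy densities
  have hG_int : ∀ L' : Fin (n + 1) → Fin 2, Integrable (fun z =>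
      ‖fderiv ℝ (fun t => χ t • iteratedFDeriv ℝ n g t (fun j => ![(1 : ℂ), Complex.I] (Fin.tail L' j))) z 1‖ ^ 2 +
      ‖fderiv ℝ (fun t => χ t • iteratedFDeriv ℝ n g t (fun j => ![(1 : ℂ), Complex.I] (Fin.tail L' j))) z
        Complex.I‖ ^ 2) := by
    intro L'
    have hW : ContDiff ℝ ∞ (fun t => χ t • iteratedFDeriv ℝ n g t (fun j => ![(1 : ℂ), Complex.I] (Fin.tail L' j))) :=
      hχc.smul (contDiff_iteratedFDeriv_apply hg n _)
    have hWc : HasCompactSupport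
        (fun t => χ t • iteratedFDeriv ℝ n g t (fun j => ![(1 : ℂ), Complex.I] (Fin.tail L' j))) :=
      hχs.smul_right
    have hc1 := (hW.continuous_fderiv (by simp)).clm_apply (continuous_const (y := (1 : ℂ)))
    have hcI := (hW.continuous_fderiv (by simp)).clm_apply (continuous_const (y := Complex.I))
    refine ((hc1.norm.pow 2).add (hcI.norm.pow 2)).integrable_of_hasCompactSupport ?_
    exact hasCompactSupport_of_eq_zero hWc fun z hz => by
      simp [fderiv_eq_zero_of_notMem_tsupport hz]
  have hcard : ((Finset.univ : Finset (Fin (n + 1) → Fin 2)).card : ℝ) = 2 ^ (n + 1) := by simp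
  calc ∫ z in closedBall (0 : ℂ) ρ', ‖iteratedFDeriv ℝ (n + 1) g z‖ ^ 2
      ≤ ∫ z in closedBall (0 : ℂ) ρ', (2 : ℝ) ^ (n + 1) * ∑ L' : Fin (n + 1) → Fin 2,
          (‖fderiv ℝ (fun t => χ t • iteratedFDeriv ℝ n g t (fun j => ![(1 : ℂ), Complex.I] (Fin.tail L' j))) z 1‖ ^ 2 +
           ‖fderiv ℝ (fun t => χ t • iteratedFDeriv ℝ n g t (fun j => ![(1 : ℂ), Complex.I] (Fin.tail L' j))) z
             Complex.I‖ ^ 2) := by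
        refine setIntegral_mono_on (integrableOn_closedBall_of_continuous ((hac _).pow 2) 0 ρ') ?_
          measurableSet_closedBall hLHS
        exact ((integrable_finsetSum _ fun L' _ => hG_int L').const_mul _).integrableOn
    _ = (2 : ℝ) ^ (n + 1) * ∑ L' : Fin (n + 1) → Fin 2, ∫ z in closedBall (0 : ℂ) ρ',
          (‖fderiv ℝ (fun t => χ t • iteratedFDeriv ℝ n g t (fun j => ![(1 : ℂ), Complex.I] (Fin.tail L' j))) z 1‖ ^ 2 +
           ‖fderiv ℝ (fun t => χ t • iteratedFDeriv ℝ n g t (fun j => ![(1 : ℂ), Complex.I] (Fin.tail L' j))) z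
             Complex.I‖ ^ 2) := by
        rw [integral_const_mul, integral_finsetSum _ fun L' _ => (hG_int L').integrableOn]
    _ ≤ (2 : ℝ) ^ (n + 1) * ∑ L' : Fin (n + 1) → Fin 2, K * (1 + I4 + I2) := by
        refine mul_le_mul_of_nonneg_left (Finset.sum_le_sum fun L' _ => ?_) (pow_nonneg zero_le_two _)
        exact (setIntegral_le_integral (hG_int L') (Filter.Eventually.of_forall fun z =>
          add_nonneg (sq_nonneg _) (sq_nonneg _))).trans (key (Fin.tail L'))
    _ = (2 : ℝ) ^ (n + 1) * 2 ^ (n + 1) * K * (1 + I4 + I2) := by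
        rw [Finset.sum_const, Finset.card_univ, ← Finset.card_univ, nsmul_eq_mul, hcard]; ring

end Literature.Geometry.Symplectic.JHolomorphicWeierstrassProof

/-!
## Part `SullivanDualWitnessChargeHelperAprioriLocal`:
### Stub `helper_aprioriLocal_of` of line `Sketch` for crux `WitnessCharge`
(stmt-SmoothPoincare4-7824, route SullivanDual)

Localisation of the landed a-priori chain of the sibling crux `TameOrBrodyR4`: the bootstrapping
induction `Apriori.bootstrap` (`…TameOrBrodyR4AprioriBootstrap`) and the final estimate
`stub_aprioriOf` (`…TameOrBrodyR4StubAprioriOf`) are copied verbatim, with the global flat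
`J`-holomorphicity `IsJHolomorphicFlat J g` replaced by the equation
`dg(z)(iζ) = J(g z)(dg(z) ζ)` on the open disc of radius `2`, and with the step `α`
(`Apriori.alpha`, the only step consuming the equation) replaced by its LOCAL form, taken as a
hypothesis (it is the neighbouring stub `helper_alphaLocal`). The equation-free steps `β`, `γ`
are the landed `Apriori.beta`, `Apriori.gamma`, fed with the landed worker stubs
`stub_ladyzhenskaya`, `stub_supBound`, `stub_normIteratedFDerivLe`.

* `bootstrap_local` : the induction — on discs of radii `r t = δ/2 + δ/(2(t+2))`, each round
  `α, α, β, α, γ` turns sup bounds on the orders `≤ m + 1` into sup bounds on the orders `≤ m + 2`;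
* `helper_aprioriLocal_of` : the registered stub — choice of the scale `δ = 1/(1 + 4M(1+M))` with
  `M ≥ ‖J‖, ‖dJ‖` on the ball of radius `R₀`, and the induction read off at the centre.
-/

open scoped ContDiff Topology Nat
open Filter Set Metric MeasureTheory Literature.Geometry.Symplectic
open Literature.Geometry.Symplectic.JHolomorphicWeierstrassProof
open Literature.Geometry.Symplectic.JHolomorphicWeierstrassProof.Apriori

namespace Literature.Geometry.Symplectic.JHolomorphicWeierstrassProof

variable {d : ℕ}
/-- **The local bootstrapping induction** (`Apriori.bootstrap` with the local step `α` as the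
hypothesis `hα` and the `J`-holomorphicity equation only on the open disc of radius `2`). With
`r t = δ/2 + δ/(2(t+2))` (radii decreasing from `3δ/4` to `δ/2`), for every `m` there is `S` with
`‖Dⁱg‖ ≤ S` on the disc of radius `r (5m)` for all `i ≤ m + 1` and all admissible `g`
(steps `α, α, β, α, γ` per round). [folklore] -/
theorem bootstrap_local
    (hα : ∀ (J : EuclideanSpace ℝ (Fin d) → EuclideanSpace ℝ (Fin d) →L[ℝ] EuclideanSpace ℝ (Fin d)),
      ContDiff ℝ ∞ J → (∀ x v, J x (J x v) = -v) →
      ∀ (R₀ M₀ M₁ : ℝ), (∀ x : EuclideanSpace ℝ (Fin d), ‖x‖ ≤ R₀ → ‖J x‖ ≤ M₀) →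
        (∀ x : EuclideanSpace ℝ (Fin d), ‖x‖ ≤ R₀ → ‖fderiv ℝ J x‖ ≤ M₁) →
      ∀ (n : ℕ), 1 ≤ n → ∀ (ρ' ρ : ℝ), 0 < ρ' → ρ' < ρ → ρ ≤ 1 →
        16 * (1 + M₀ ^ 2) * M₁ ^ 2 * ρ ^ 2 ≤ 1 → ∀ (S : ℝ),
      ∃ C : ℝ, ∀ g : ℂ → EuclideanSpace ℝ (Fin d), ContDiff ℝ ∞ g →
        (∀ z : ℂ, ‖z‖ < 2 → ∀ ζ : ℂ, fderiv ℝ g z (Complex.I * ζ) = J (g z) (fderiv ℝ g z ζ)) →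
        (∀ z : ℂ, ‖z‖ ≤ 1 → ‖g z‖ ≤ R₀) → (∀ z : ℂ, ‖z‖ ≤ 1 → ‖fderiv ℝ g z‖ ≤ 2) →
        (∀ i, 1 ≤ i → i + 2 ≤ n → ∀ z : ℂ, ‖z‖ ≤ ρ → ‖iteratedFDeriv ℝ i g z‖ ≤ S) →
        ∫ z in Metric.closedBall (0 : ℂ) ρ', ‖iteratedFDeriv ℝ (n + 1) g z‖ ^ 2 ≤
          C * (1 + (∫ z in Metric.closedBall (0 : ℂ) ρ, ‖iteratedFDeriv ℝ (n - 1) g z‖ ^ 4) +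
            ∫ z in Metric.closedBall (0 : ℂ) ρ, ‖iteratedFDeriv ℝ n g z‖ ^ 2))
    {J : EuclideanSpace ℝ (Fin d) → EuclideanSpace ℝ (Fin d) →L[ℝ] EuclideanSpace ℝ (Fin d)}
    (hJs : ContDiff ℝ ∞ J) (hJ2 : ∀ x v, J x (J x v) = -v)
    {R₀ M₀ M₁ : ℝ} (hM₀ : ∀ x : EuclideanSpace ℝ (Fin d), ‖x‖ ≤ R₀ → ‖J x‖ ≤ M₀)
    (hM₁ : ∀ x : EuclideanSpace ℝ (Fin d), ‖x‖ ≤ R₀ → ‖fderiv ℝ J x‖ ≤ M₁)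
    {δ : ℝ} (hδ0 : 0 < δ) (hδ1 : δ ≤ 1) (hδ : 16 * (1 + M₀ ^ 2) * M₁ ^ 2 * δ ^ 2 ≤ 1) (m : ℕ) :
    ∃ S : ℝ, ∀ g : ℂ → EuclideanSpace ℝ (Fin d), ContDiff ℝ ∞ g →
      (∀ z : ℂ, ‖z‖ < 2 → ∀ ζ : ℂ, fderiv ℝ g z (Complex.I * ζ) = J (g z) (fderiv ℝ g z ζ)) →
      (∀ z : ℂ, ‖z‖ ≤ 1 → ‖g z‖ ≤ R₀) → (∀ z : ℂ, ‖z‖ ≤ 1 → ‖fderiv ℝ g z‖ ≤ 2) →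
      ∀ i, i ≤ m + 1 → ∀ z : ℂ, ‖z‖ ≤ δ / 2 + δ / (2 * ((5 * m : ℕ) + 2)) →
        ‖iteratedFDeriv ℝ i g z‖ ≤ S := by
  -- adapted from `Apriori.bootstrap` (…TameOrBrodyR4AprioriBootstrap): `alpha ↦ hα`
  -- the radii
  obtain ⟨r, hr⟩ : ∃ r : ℕ → ℝ, r = fun t : ℕ => δ / 2 + δ / (2 * ((t : ℝ) + 2)) := ⟨_, rfl⟩
  have hr5 : ∀ m : ℕ, r (5 * m) = δ / 2 + δ / (2 * ((5 * m : ℕ) + 2)) := fun m => by rw [hr]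
  have hr_pos : ∀ t, 0 < r t := fun t => by rw [hr]; positivity
  have hr_le : ∀ t, r t ≤ δ := fun t => by
    rw [hr]
    have : δ / (2 * ((t : ℝ) + 2)) ≤ δ / 2 :=
      div_le_div_of_nonneg_left hδ0.le (by norm_num)
        (by nlinarith [(Nat.cast_nonneg t : (0 : ℝ) ≤ t)])
    show δ / 2 + δ / (2 * ((t : ℝ) + 2)) ≤ δ
    linarith
  have hr_anti : ∀ t t' : ℕ, t ≤ t' → r t' ≤ r t := fun t t' htt => by
    rw [hr]
    have : δ / (2 * ((t' : ℝ) + 2)) ≤ δ / (2 * ((t : ℝ) + 2)) :=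
      div_le_div_of_nonneg_left hδ0.le (by positivity) (by
        have : (t : ℝ) ≤ t' := by exact_mod_cast htt
        linarith)
    show δ / 2 + δ / (2 * ((t' : ℝ) + 2)) ≤ δ / 2 + δ / (2 * ((t : ℝ) + 2))
    linarith
  have hr_lt : ∀ t : ℕ, r (t + 1) < r t := fun t => by
    rw [hr]
    have : δ / (2 * (((t + 1 : ℕ) : ℝ) + 2)) < δ / (2 * ((t : ℝ) + 2)) :=
      div_lt_div_of_pos_left hδ0 (by positivity) (by push_cast; linarith)
    show δ / 2 + δ / (2 * (((t + 1 : ℕ) : ℝ) + 2)) < δ / 2 + δ / (2 * ((t : ℝ) + 2))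
    linarith
  have hr1 : ∀ t, r t ≤ 1 := fun t => (hr_le t).trans hδ1
  have hrδ : ∀ t, 16 * (1 + M₀ ^ 2) * M₁ ^ 2 * r t ^ 2 ≤ 1 := fun t => by
    have : r t ^ 2 ≤ δ ^ 2 := pow_le_pow_left₀ (hr_pos t).le (hr_le t) 2
    have h0 : 0 ≤ 16 * (1 + M₀ ^ 2) * M₁ ^ 2 := by positivity
    nlinarith [mul_le_mul_of_nonneg_left this h0]
  -- restate the goal with `r`
  suffices H : ∃ S : ℝ, ∀ g : ℂ → EuclideanSpace ℝ (Fin d), ContDiff ℝ ∞ g →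
      (∀ z : ℂ, ‖z‖ < 2 → ∀ ζ : ℂ, fderiv ℝ g z (Complex.I * ζ) = J (g z) (fderiv ℝ g z ζ)) →
      (∀ z : ℂ, ‖z‖ ≤ 1 → ‖g z‖ ≤ R₀) → (∀ z : ℂ, ‖z‖ ≤ 1 → ‖fderiv ℝ g z‖ ≤ 2) →
      ∀ i, i ≤ m + 1 → ∀ z : ℂ, ‖z‖ ≤ r (5 * m) → ‖iteratedFDeriv ℝ i g z‖ ≤ S by
    obtain ⟨S, hS'⟩ := H
    exact ⟨S, fun g hg hgJ hg0 hg1 i hi z hz => hS' g hg hgJ hg0 hg1 i hi z (by rw [hr5]; exact hz)⟩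
  induction m with
  | zero =>
    refine ⟨max R₀ 2, fun g hg hgJ hg0 hg1 i hi z hz => ?_⟩
    have hz1 : ‖z‖ ≤ 1 := hz.trans (hr1 _)
    interval_cases i
    · rw [norm_iteratedFDeriv_zero]; exact (hg0 z hz1).trans (le_max_left _ _)
    · rw [norm_iteratedFDeriv_one]; exact (hg1 z hz1).trans (le_max_right _ _)
  | succ m ih =>
    obtain ⟨S, hSb⟩ := ih
    -- the five steps, with their `g`-independent constants
    have hn1 : 1 ≤ m + 1 := by omega
    obtain ⟨CA, hCA⟩ := hα J hJs hJ2 R₀ M₀ M₁ hM₀ hM₁ (m + 1) hn1 (r (5 * m + 1)) (r (5 * m))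
      (hr_pos (5 * m + 1)) (hr_lt (5 * m)) (hr1 _) (hrδ _) S
    obtain ⟨CB, hCB⟩ := hα J hJs hJ2 R₀ M₀ M₁ hM₀ hM₁ (m + 2) (by omega) (r (5 * m + 2))
      (r (5 * m + 1)) (hr_pos (5 * m + 2)) (hr_lt (5 * m + 1)) (hr1 _) (hrδ _) S
    obtain ⟨CC, hCC⟩ := beta stub_ladyzhenskaya stub_normIteratedFDerivLe (m + 2)
      (hr_pos (5 * m + 3)) (hr_lt (5 * m + 2))
    obtain ⟨CD, hCD⟩ := hα J hJs hJ2 R₀ M₀ M₁ hM₀ hM₁ (m + 3) (by omega) (r (5 * m + 4))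
      (r (5 * m + 3)) (hr_pos (5 * m + 4)) (hr_lt (5 * m + 3)) (hr1 _) (hrδ _) S
    obtain ⟨CE, hCE⟩ := gamma stub_supBound stub_normIteratedFDerivLe (m + 2)
      (hr_pos (5 * m + 5)) (hr_lt (5 * m + 4))
    -- volumes
    obtain ⟨V0, hV0⟩ : ∃ V : ℝ, V = (volume (closedBall (0 : ℂ) (r (5 * m)))).toReal := ⟨_, rfl⟩
    obtain ⟨V1, hV1⟩ : ∃ V : ℝ, V = (volume (closedBall (0 : ℂ) (r (5 * m + 1)))).toReal :=
      ⟨_, rfl⟩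
    -- the propagated bounds
    obtain ⟨Q₁, hQ₁⟩ : ∃ Q : ℝ, Q = |CA| * (1 + V0 * (max S |R₀|) ^ 4 + V0 * S ^ 2) := ⟨_, rfl⟩
    obtain ⟨Q₂, hQ₂⟩ : ∃ Q : ℝ, Q = |CB| * (1 + V1 * S ^ 4 + Q₁) := ⟨_, rfl⟩
    obtain ⟨P, hP⟩ : ∃ Q : ℝ, Q = |CC| * (Q₁ * (Q₂ + Q₁)) := ⟨_, rfl⟩
    obtain ⟨Q₃, hQ₃⟩ : ∃ Q : ℝ, Q = |CD| * (1 + P + Q₂) := ⟨_, rfl⟩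
    refine ⟨max S (|CE| * (1 + Q₃ + Q₂ + Q₁)), fun g hg hgJ hg0 hg1 i hi z hz => ?_⟩
    have hac : ∀ k, Continuous fun z => ‖iteratedFDeriv ℝ k g z‖ := fun k =>
      (hg.continuous_iteratedFDeriv (m := k) (by exact_mod_cast le_top)).norm
    have hnn : ∀ (k p : ℕ) (ρ : ℝ), 0 ≤ ∫ z in closedBall (0 : ℂ) ρ, ‖iteratedFDeriv ℝ k g z‖ ^ p :=
      fun k p ρ => setIntegral_norm_pow_nonneg g k p ρ
    -- sup bounds from the induction hypothesis, on the disc of radius `r (5m)` and inside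
    have hsup : ∀ i, i ≤ m + 1 → ∀ t, 5 * m ≤ t → ∀ z ∈ closedBall (0 : ℂ) (r t),
        ‖iteratedFDeriv ℝ i g z‖ ≤ S := fun i hi t ht z hz =>
      hSb g hg hgJ hg0 hg1 i hi z ((mem_closedBall_zero_iff.mp hz).trans (hr_anti _ _ ht))
    -- step A
    have hA : ∫ z in closedBall (0 : ℂ) (r (5 * m + 1)), ‖iteratedFDeriv ℝ (m + 1 + 1) g z‖ ^ 2 ≤
        Q₁ := by
      have h := hCA g hg hgJ hg0 hg1 (fun i hi1 hi2 z hz =>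
        hsup i (by omega) (5 * m) le_rfl z (mem_closedBall_zero_iff.mpr hz))
      refine h.trans ?_
      rw [hQ₁]
      have i4 : ∫ z in closedBall (0 : ℂ) (r (5 * m)), ‖iteratedFDeriv ℝ (m + 1 - 1) g z‖ ^ 4 ≤
          V0 * (max S |R₀|) ^ 4 := by
        rw [hV0]
        refine setIntegral_pow_le_of_le (hac (m + 1 - 1)) (fun z => norm_nonneg _)
          (fun z hz => ?_) 4
        rcases Nat.eq_zero_or_pos m with hm | hm
        · subst hm
          show ‖iteratedFDeriv ℝ 0 g z‖ ≤ _
          rw [norm_iteratedFDeriv_zero]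
          exact ((hg0 z ((mem_closedBall_zero_iff.mp hz).trans (hr1 _))).trans
            (le_abs_self _)).trans (le_max_right _ _)
        · exact (hsup (m + 1 - 1) (by omega) (5 * m) le_rfl z hz).trans (le_max_left _ _)
      have i2 : ∫ z in closedBall (0 : ℂ) (r (5 * m)), ‖iteratedFDeriv ℝ (m + 1) g z‖ ^ 2 ≤
          V0 * S ^ 2 := by
        rw [hV0]
        exact setIntegral_pow_le_of_le (hac _) (fun z => norm_nonneg _)
          (fun z hz => hsup (m + 1) le_rfl (5 * m) le_rfl z hz) 2
      have hx4 := hnn (m + 1 - 1) 4 (r (5 * m))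
      have hx2 := hnn (m + 1) 2 (r (5 * m))
      calc CA * _ ≤ |CA| * _ := mul_le_mul_of_nonneg_right (le_abs_self _) (by linarith)
        _ ≤ _ := mul_le_mul_of_nonneg_left (by linarith) (abs_nonneg _)
    have hQ₁0 : 0 ≤ Q₁ := (hnn _ _ _).trans hA
    -- step B
    have hBstep : ∫ z in closedBall (0 : ℂ) (r (5 * m + 2)),
        ‖iteratedFDeriv ℝ (m + 2 + 1) g z‖ ^ 2 ≤ Q₂ := by
      have h := hCB g hg hgJ hg0 hg1 (fun i hi1 hi2 z hz =>
        hsup i (by omega) (5 * m + 1) (by omega) z (mem_closedBall_zero_iff.mpr hz))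
      refine h.trans ?_
      rw [hQ₂]
      have i4 : ∫ z in closedBall (0 : ℂ) (r (5 * m + 1)), ‖iteratedFDeriv ℝ (m + 2 - 1) g z‖ ^ 4 ≤
          V1 * S ^ 4 := by
        rw [hV1]
        exact setIntegral_pow_le_of_le (hac _) (fun z => norm_nonneg _)
          (fun z hz => hsup (m + 2 - 1) (by omega) (5 * m + 1) (by omega) z hz) 4
      have hA' : ∫ z in closedBall (0 : ℂ) (r (5 * m + 1)),
          ‖iteratedFDeriv ℝ (m + 2) g z‖ ^ 2 ≤ Q₁ := hA
      have hx4 := hnn (m + 2 - 1) 4 (r (5 * m + 1))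
      have hx2 := hnn (m + 2) 2 (r (5 * m + 1))
      calc CB * _ ≤ |CB| * _ := mul_le_mul_of_nonneg_right (le_abs_self _) (by linarith)
        _ ≤ _ := mul_le_mul_of_nonneg_left (by linarith) (abs_nonneg _)
    have hQ₂0 : 0 ≤ Q₂ := (hnn _ _ _).trans hBstep
    -- step C
    have hA2 : ∫ z in closedBall (0 : ℂ) (r (5 * m + 2)), ‖iteratedFDeriv ℝ (m + 2) g z‖ ^ 2 ≤ Q₁ :=
      (setIntegral_closedBall_mono ((hac (m + 2)).pow 2) (fun z => pow_nonneg (norm_nonneg _) 2)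
        (hr_lt _).le).trans hA
    have hB2 : ∫ z in closedBall (0 : ℂ) (r (5 * m + 2)), ‖iteratedFDeriv ℝ (m + 2 + 1) g z‖ ^ 2 ≤
        Q₂ := hBstep
    have hCstep : ∫ z in closedBall (0 : ℂ) (r (5 * m + 3)), ‖iteratedFDeriv ℝ (m + 2) g z‖ ^ 4 ≤
        P := by
      refine (hCC g hg).trans ?_
      rw [hP]
      have hx : (∫ z in closedBall (0 : ℂ) (r (5 * m + 2)), ‖iteratedFDeriv ℝ (m + 2) g z‖ ^ 2) *
          ((∫ z in closedBall (0 : ℂ) (r (5 * m + 2)), ‖iteratedFDeriv ℝ (m + 2 + 1) g z‖ ^ 2) +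
            ∫ z in closedBall (0 : ℂ) (r (5 * m + 2)), ‖iteratedFDeriv ℝ (m + 2) g z‖ ^ 2) ≤
          Q₁ * (Q₂ + Q₁) :=
        mul_le_mul hA2 (add_le_add hB2 hA2) (add_nonneg (hnn _ _ _) (hnn _ _ _)) hQ₁0
      have hpos : 0 ≤
          (∫ z in closedBall (0 : ℂ) (r (5 * m + 2)), ‖iteratedFDeriv ℝ (m + 2) g z‖ ^ 2) *
          ((∫ z in closedBall (0 : ℂ) (r (5 * m + 2)), ‖iteratedFDeriv ℝ (m + 2 + 1) g z‖ ^ 2) +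
            ∫ z in closedBall (0 : ℂ) (r (5 * m + 2)), ‖iteratedFDeriv ℝ (m + 2) g z‖ ^ 2) :=
        mul_nonneg (hnn _ _ _) (add_nonneg (hnn _ _ _) (hnn _ _ _))
      calc CC * _ ≤ |CC| * _ := mul_le_mul_of_nonneg_right (le_abs_self _) hpos
        _ ≤ _ := mul_le_mul_of_nonneg_left hx (abs_nonneg _)
    have hP0 : 0 ≤ P := (hnn _ _ _).trans hCstep
    -- step D
    have hDstep : ∫ z in closedBall (0 : ℂ) (r (5 * m + 4)),
        ‖iteratedFDeriv ℝ (m + 3 + 1) g z‖ ^ 2 ≤ Q₃ := by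
      have h := hCD g hg hgJ hg0 hg1 (fun i hi1 hi2 z hz =>
        hsup i (by omega) (5 * m + 3) (by omega) z (mem_closedBall_zero_iff.mpr hz))
      refine h.trans ?_
      rw [hQ₃]
      have hC3 : ∫ z in closedBall (0 : ℂ) (r (5 * m + 3)), ‖iteratedFDeriv ℝ (m + 3 - 1) g z‖ ^ 4 ≤
          P := hCstep
      have hB3 : ∫ z in closedBall (0 : ℂ) (r (5 * m + 3)), ‖iteratedFDeriv ℝ (m + 3) g z‖ ^ 2 ≤
          Q₂ :=
        (setIntegral_closedBall_mono ((hac (m + 3)).pow 2) (fun z => pow_nonneg (norm_nonneg _) 2)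
          (hr_lt _).le).trans hBstep
      have hx4 := hnn (m + 3 - 1) 4 (r (5 * m + 3))
      have hx2 := hnn (m + 3) 2 (r (5 * m + 3))
      calc CD * _ ≤ |CD| * _ := mul_le_mul_of_nonneg_right (le_abs_self _) (by linarith)
        _ ≤ _ := mul_le_mul_of_nonneg_left (by linarith) (abs_nonneg _)
    -- step E
    have hEstep : ∀ z ∈ closedBall (0 : ℂ) (r (5 * m + 5)), ‖iteratedFDeriv ℝ (m + 2) g z‖ ≤
        |CE| * (1 + Q₃ + Q₂ + Q₁) := by
      intro z hz
      refine (hCE g hg z hz).trans ?_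
      have hD4 : ∫ z in closedBall (0 : ℂ) (r (5 * m + 4)), ‖iteratedFDeriv ℝ (m + 2 + 2) g z‖ ^ 2 ≤
          Q₃ := hDstep
      have hB4 : ∫ z in closedBall (0 : ℂ) (r (5 * m + 4)), ‖iteratedFDeriv ℝ (m + 2 + 1) g z‖ ^ 2 ≤
          Q₂ :=
        (setIntegral_closedBall_mono ((hac (m + 2 + 1)).pow 2)
          (fun z => pow_nonneg (norm_nonneg _) 2) (hr_anti _ _ (by omega))).trans hBstep
      have hA4 : ∫ z in closedBall (0 : ℂ) (r (5 * m + 4)), ‖iteratedFDeriv ℝ (m + 2) g z‖ ^ 2 ≤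
          Q₁ :=
        (setIntegral_closedBall_mono ((hac (m + 2)).pow 2) (fun z => pow_nonneg (norm_nonneg _) 2)
          (hr_anti _ _ (by omega))).trans hA
      have hx1 := hnn (m + 2 + 2) 2 (r (5 * m + 4))
      have hx2 := hnn (m + 2 + 1) 2 (r (5 * m + 4))
      have hx3 := hnn (m + 2) 2 (r (5 * m + 4))
      calc CE * _ ≤ |CE| * _ := mul_le_mul_of_nonneg_right (le_abs_self _) (by linarith)
        _ ≤ _ := mul_le_mul_of_nonneg_left (by linarith) (abs_nonneg _)
    -- conclusion
    have e5 : 5 * (m + 1) = 5 * m + 5 := by ring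
    rw [e5] at hz
    rcases Nat.lt_or_ge i (m + 2) with hlt | hge
    · exact (hsup i (by omega) (5 * m + 5) (by omega) z (mem_closedBall_zero_iff.mpr hz)).trans
        (le_max_left _ _)
    · have hi2 : i = m + 2 := by omega
      subst hi2
      exact (hEstep z (mem_closedBall_zero_iff.mpr hz)).trans (le_max_right _ _)

/-- **Stub `helper_aprioriLocal_of` (local a priori estimate from the local step `α`;
`Apriori.bootstrap` + `stub_aprioriOf` of the `TameOrBrodyR4` chain, localised).** Assuming the
local step `α` (the neighbouring stub `helper_alphaLocal`), for every `C^∞` almost complex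
structure `J` on `ℝ⁴`, every `R₀` and every order `k` there is a constant `C` such that every
`C^∞` map `g : ℂ → ℝ⁴` that is flat `J`-holomorphic on the open disc of radius `2`, with
`‖g‖ ≤ R₀` and `‖dg‖ ≤ 2` on the closed unit disc, satisfies `‖D^k g(0)‖ ≤ C`. Proof: with
`M ≥ ‖J‖, ‖dJ‖` on the ball of radius `R₀` and `δ = 1/(1 + 4M(1+M))` (so `16(1+M²)M²δ² ≤ 1`),
the local bootstrapping induction `bootstrap_local` bounds `‖Dⁱg‖` for `i ≤ k + 1` on the disc
of radius `r(5k) ∋ 0`. [folklore] -/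
theorem helper_aprioriLocal_of :
    (∀ (J : EuclideanSpace ℝ (Fin d) → EuclideanSpace ℝ (Fin d) →L[ℝ] EuclideanSpace ℝ (Fin d)),
      ContDiff ℝ ∞ J → (∀ x v, J x (J x v) = -v) →
    ∀ (R₀ M₀ M₁ : ℝ), (∀ x : EuclideanSpace ℝ (Fin d), ‖x‖ ≤ R₀ → ‖J x‖ ≤ M₀) →
      (∀ x : EuclideanSpace ℝ (Fin d), ‖x‖ ≤ R₀ → ‖fderiv ℝ J x‖ ≤ M₁) →
    ∀ (n : ℕ), 1 ≤ n → ∀ (ρ' ρ : ℝ), 0 < ρ' → ρ' < ρ → ρ ≤ 1 →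
      16 * (1 + M₀ ^ 2) * M₁ ^ 2 * ρ ^ 2 ≤ 1 → ∀ (S : ℝ),
    ∃ C : ℝ, ∀ g : ℂ → EuclideanSpace ℝ (Fin d), ContDiff ℝ ∞ g →
      (∀ z : ℂ, ‖z‖ < 2 → ∀ ζ : ℂ, fderiv ℝ g z (Complex.I * ζ) = J (g z) (fderiv ℝ g z ζ)) →
      (∀ z : ℂ, ‖z‖ ≤ 1 → ‖g z‖ ≤ R₀) → (∀ z : ℂ, ‖z‖ ≤ 1 → ‖fderiv ℝ g z‖ ≤ 2) →
      (∀ i, 1 ≤ i → i + 2 ≤ n → ∀ z : ℂ, ‖z‖ ≤ ρ → ‖iteratedFDeriv ℝ i g z‖ ≤ S) →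
      ∫ z in Metric.closedBall (0 : ℂ) ρ', ‖iteratedFDeriv ℝ (n + 1) g z‖ ^ 2 ≤
        C * (1 + (∫ z in Metric.closedBall (0 : ℂ) ρ, ‖iteratedFDeriv ℝ (n - 1) g z‖ ^ 4) +
          ∫ z in Metric.closedBall (0 : ℂ) ρ, ‖iteratedFDeriv ℝ n g z‖ ^ 2)) →
    ∀ (J : EuclideanSpace ℝ (Fin d) → EuclideanSpace ℝ (Fin d) →L[ℝ] EuclideanSpace ℝ (Fin d)),
      ContDiff ℝ ∞ J → (∀ x v, J x (J x v) = -v) → ∀ (R₀ : ℝ) (k : ℕ),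
    ∃ C : ℝ, ∀ g : ℂ → EuclideanSpace ℝ (Fin d), ContDiff ℝ ∞ g →
      (∀ z : ℂ, ‖z‖ < 2 → ∀ ζ : ℂ, fderiv ℝ g z (Complex.I * ζ) = J (g z) (fderiv ℝ g z ζ)) →
      (∀ z : ℂ, ‖z‖ ≤ 1 → ‖g z‖ ≤ R₀) → (∀ z : ℂ, ‖z‖ ≤ 1 → ‖fderiv ℝ g z‖ ≤ 2) →
      ‖iteratedFDeriv ℝ k g 0‖ ≤ C := by
  intro hα J hJs hJ2 R₀ k
  -- adapted from `stub_aprioriOf` (…TameOrBrodyR4StubAprioriOf): `bootstrap ↦ bootstrap_local`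
  -- degenerate case `R₀ < 0`
  rcases lt_or_ge R₀ 0 with hR | hR
  · refine ⟨0, fun g _ _ hg0 _ => ?_⟩
    exact absurd ((norm_nonneg (g 0)).trans (hg0 0 (by simp))) (not_le.mpr hR)
  -- bounds for `J` and `dJ` on the ball of radius `R₀`
  obtain ⟨M, hM⟩ := exists_bound_iteratedFDeriv hJs R₀ 1
  have hM₀ : ∀ x : EuclideanSpace ℝ (Fin d), ‖x‖ ≤ R₀ → ‖J x‖ ≤ M := fun x hx => by
    have h := hM 0 (Nat.zero_le _) x hx
    rwa [norm_iteratedFDeriv_zero] at h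
  have hM₁ : ∀ x : EuclideanSpace ℝ (Fin d), ‖x‖ ≤ R₀ → ‖fderiv ℝ J x‖ ≤ M := fun x hx => by
    have h := hM 1 le_rfl x hx
    rwa [← norm_iteratedFDeriv_fderiv, norm_iteratedFDeriv_zero] at h
  have hMnn : 0 ≤ M := (norm_nonneg _).trans (hM₀ 0 (by simpa using hR))
  -- the scale `δ`
  obtain ⟨δ, hδdef⟩ : ∃ δ : ℝ, δ = 1 / (1 + 4 * M * (1 + M)) := ⟨_, rfl⟩
  have hD : 1 ≤ 1 + 4 * M * (1 + M) := by nlinarith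
  have hδ0 : 0 < δ := by rw [hδdef]; positivity
  have hδ1 : δ ≤ 1 := by rw [hδdef]; exact div_le_one_of_le₀ hD (by positivity)
  have hδ : 16 * (1 + M ^ 2) * M ^ 2 * δ ^ 2 ≤ 1 := by
    have hx : 4 * M * (1 + M) * δ ≤ 1 := by
      rw [hδdef, mul_one_div]
      exact div_le_one_of_le₀ (by linarith) (by positivity)
    have hx0 : 0 ≤ 4 * M * (1 + M) * δ := by positivity
    have hsq : (4 * M * (1 + M) * δ) ^ 2 ≤ 1 := by nlinarith
    have hcmp : 16 * (1 + M ^ 2) * M ^ 2 * δ ^ 2 ≤ (4 * M * (1 + M) * δ) ^ 2 := by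
      have : 1 + M ^ 2 ≤ (1 + M) ^ 2 := by nlinarith
      have h0 : 0 ≤ 16 * M ^ 2 * δ ^ 2 := by positivity
      nlinarith [mul_le_mul_of_nonneg_left this h0]
    exact hcmp.trans hsq
  obtain ⟨S, hSb⟩ := bootstrap_local hα hJs hJ2 hM₀ hM₁ hδ0 hδ1 hδ k
  refine ⟨S, fun g hg hgJ hg0 hg1 => hSb g hg hgJ hg0 hg1 k (Nat.le_succ k) 0 ?_⟩
  rw [norm_zero]
  positivity

end Literature.Geometry.Symplectic.JHolomorphicWeierstrassProof

/-!
## Part `SullivanDualWitnessChargeWeierstrass`: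
### The generalized Weierstraß theorem for `J`-holomorphic maps, flat `ℝ⁴` form — PROVED

Crux `WitnessCharge` (stmt-SmoothPoincare4-7824), line `Sketch` (idea `pencil-incompleteness`),
continuation lead c2, cycle 3. This file DISCHARGES the named fact
`Literature.Geometry.Symplectic.JHolomorphicWeierstrassR4` (Hummel 1997, Ch. III Prop. 3.1 in the
flat four-dimensional special case recorded in `Literature/Geometry/Symplectic/JHolomorphicWeierstrass.lean`):
for a `C^∞` almost complex structure `J` on `ℝ⁴`, maps `u n : ℂ → ℝ⁴` that are `C^∞` and flat
`J`-holomorphic on an open `U ⊆ ℂ` and converge locally uniformly on `U` to `v` have a limit that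
is `C^∞` and `J`-holomorphic on `U`, and `d(u n) → dv` locally uniformly on `U`.

It is the input L3 ("Gromov–Schwarz / elliptic regularity") of the rescaling branch of the line
(`helper_rescaleLocal`, `helper_rescaleAway`, which take it as a hypothesis) and of the cruxes
`TameOrBrodyR4` / `HyperbolicEnd` of the same route.

## Proof (assembled from the registered helper stubs of wave 1)

* `helper_alphaLocal` + `helper_aprioriLocal_of`: the `L²` elliptic bootstrapping chain landed for
  `TameOrBrodyR4` (`…TameOrBrodyR4Apriori*`: two integrations by parts, Ladyzhenskaya, a sup bound,
  induction `α α β α γ`), LOCALISED — the equation is only used on the open disc of radius `2` —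
  gives `‖Dᵏg(0)‖ ≤ C(J, R₀, k)` for `g` smooth, `J`-holomorphic on that disc, `‖g‖ ≤ R₀` and
  `‖dg‖ ≤ 2` on the closed unit disc (McDuff–Salamon 2012, Thm B.4.2 with `p = ∞`, in `L²` form).
* `helper_derivBoundsLocal_of`: cover a compact `K ⊆ U`, translate, rescale and cut off, to get
  bounds on all derivatives on `K`, uniform in `n`, from `C⁰` and `C¹` bounds on compacts.
* `helper_gradBoundOfC0_of`: `C⁰_loc` convergence forces the `C¹` bounds (Zalcman rescaling at a
  blow-up point would produce maps with unit gradient at the origin converging in `C¹` to a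
  constant).
* `helper_smoothLimitLocal`: derivative bounds + locally uniform convergence ⇒ the limit is `C^∞`
  on `U` and the first derivatives converge locally uniformly; the equation passes to the limit
  pointwise.
-/

open scoped ContDiff Topology
open Filter Set Metric Literature.Geometry.Symplectic

namespace Literature.Geometry.Symplectic.JHolomorphicWeierstrassProof

variable {d : ℕ}
/-- **`C⁰` bounds on compact subsets** for maps continuous on an open `U` converging locally
uniformly on `U`. [folklore] -/
theorem weierstrass_c0Bound {U : Set ℂ} (hU : IsOpen U)
    {u : ℕ → ℂ → EuclideanSpace ℝ (Fin d)} {v : ℂ → EuclideanSpace ℝ (Fin d)}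
    (hu : ∀ n, ContinuousOn (u n) U) (hlim : TendstoLocallyUniformlyOn u v atTop U) :
    ∀ K : Set ℂ, IsCompact K → K ⊆ U →
      ∃ R : ℝ, ∀ n, ∀ z ∈ K, ‖u n z‖ ≤ R := by
  intro K hK hKU
  have hunif : TendstoUniformlyOn u v atTop K :=
    (tendstoLocallyUniformlyOn_iff_forall_isCompact hU).mp hlim K hKU hK
  exact GradBound.exists_bound_of_tendstoUniformlyOn hK (fun n => (hu n).mono hKU) hunif

/-- **The generalized Weierstraß theorem for flat `J`-holomorphic maps into `ℝ⁴` (Hummel 1997,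
Ch. III Prop. 3.1; McDuff–Salamon 2012, Thm B.4.2): the named fact
`Literature.Geometry.Symplectic.JHolomorphicWeierstrassR4` holds.** [folklore] -/
theorem jHolomorphicWeierstrassR4_holds : JHolomorphicWeierstrassR4 := by
  intro J hJs hJ2 U hU u v hu huJ hlim
  -- the four analytic inputs
  have hAPL := helper_aprioriLocal_of (d := 4) helper_alphaLocal
  have hDBL := helper_derivBoundsLocal_of hAPL
  have hGB := helper_gradBoundOfC0_of hDBL helper_smoothLimitLocal J hJs hJ2 U hU u v hu huJ hlim
  have hC0 := weierstrass_c0Bound hU (fun n => (hu n).continuousOn) hlim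
  have hD := hDBL J hJs hJ2 U hU u hu huJ hC0 hGB
  obtain ⟨hv, hd⟩ := helper_smoothLimitLocal U hU u v hu hD hlim
  refine ⟨hv, fun z hz ζ => ?_, hd⟩
  -- the equation passes to the limit pointwise
  have hev : Continuous fun p : (EuclideanSpace ℝ (Fin 4) →L[ℝ] EuclideanSpace ℝ (Fin 4)) ×
      EuclideanSpace ℝ (Fin 4) => p.1 p.2 :=
    isBoundedBilinearMap_apply.continuous
  have hTz : Tendsto (fun n => fderiv ℝ (u n) z) atTop (𝓝 (fderiv ℝ v z)) := hd.tendsto_at hz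
  have huz : Tendsto (fun n => u n z) atTop (𝓝 (v z)) := hlim.tendsto_at hz
  have h1 : Tendsto (fun n => fderiv ℝ (u n) z (Complex.I * ζ)) atTop
      (𝓝 (fderiv ℝ v z (Complex.I * ζ))) :=
    ((continuous_id.clm_apply continuous_const).tendsto (fderiv ℝ v z)).comp hTz
  have h2 : Tendsto (fun n => J (u n z) (fderiv ℝ (u n) z ζ)) atTop
      (𝓝 (J (v z) (fderiv ℝ v z ζ))) := by
    have hJt : Tendsto (fun n => J (u n z)) atTop (𝓝 (J (v z))) :=
      (hJs.continuous.tendsto (v z)).comp huz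
    have hdζ : Tendsto (fun n => fderiv ℝ (u n) z ζ) atTop (𝓝 (fderiv ℝ v z ζ)) :=
      ((continuous_id.clm_apply continuous_const).tendsto (fderiv ℝ v z)).comp hTz
    exact (hev.tendsto (J (v z), fderiv ℝ v z ζ)).comp (hJt.prodMk_nhds hdζ)
  have heq : (fun n => fderiv ℝ (u n) z (Complex.I * ζ)) =
      fun n => J (u n z) (fderiv ℝ (u n) z ζ) := funext fun n => huJ n z hz ζ
  rw [heq] at h1
  exact tendsto_nhds_unique h1 h2

end Literature.Geometry.Symplectic.JHolomorphicWeierstrassProof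

namespace Literature.Geometry.Symplectic

/-- **The generalized Weierstraß theorem for flat `J`-holomorphic maps into `ℝ⁴` (Hummel 1997,
Ch. III Prop. 3.1; McDuff–Salamon 2012, Thm B.4.2): the named fact
`Literature.Geometry.Symplectic.JHolomorphicWeierstrassR4` holds.**
[cite: Hummel1997, Ch. III Prop. 3.1] -/
theorem JHolomorphicWeierstrassR4_holds : JHolomorphicWeierstrassR4 :=
  JHolomorphicWeierstrassProof.jHolomorphicWeierstrassR4_holds

end Literature.Geometry.Symplectic

end
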